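import Literature.AlgebraicGeometry.Motives.HodgeThetaSubalgebraSymplecticRankSix
import Literature.AlgebraicGeometry.Motives.HodgeThetaSubalgebraUnitary
import HarnessLib

/-!
# The `Θ`-subalgebra theorem for unitary type `(2,3)` (and the rank-one idempotent for `(a, a+1)`), complex core: an irreducible bracket-closed `𝔊 ∋ 1, Θ` with `Θ`-eigenspaces of dimensions `2, 3` is `End(W)` (Ribet 1983 Thm. 3 at multiplicities `(2,3)`, the Lie step beyond type one, classification-free; Moonen–Zarhin 1999 §2 (2.4), Type IV(1) in dimension 5)

Family `hodge`, layer `Literature/AlgebraicGeometry/Motives` (pure complex linear algebra; no geometry). Research context: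
cell `pub-hodge-ring2` (HONEST FRAMING: research route conditional on HC_CM; not a corollary; Q11.4-sentence-2 already
refuted in dim ≥ 3), Literature lane (lit gen 66, heir item H4b = shape (S2) of
`Summit.HodgeConjecture.Ring2.FivefoldFactTwoShapes`). UNCONDITIONAL; theorems only — no definition, no named fact
(D-0026), no `sorry`. This file is no step towards a summit statement by itself: it is the algebraic heart of the
planned THEOREM L″ (the tree's THEOREM L′, `Motives/HodgeThetaSubalgebraUnitary`, carries the line «TODO(general form):
coprime `(n', n'')` with `min ≥ 2` needs Serre's Prop. 5» — the present file replaces Serre's Prop. 5 for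
`(n', n'') = (a, a+1)` by an explicit polynomial identity).

THE PRINT. K. A. Ribet, Amer. J. Math. 105 (1983), Thm. 3 (Gordon's survey, Thm. 6.3.3 and its proof sketch pp. 18–19:
«`End⁰(A) = K` imaginary quadratic, multiplicities `n'`, `n''` relatively prime ⟹ `Hg(A) = U_K(V,ψ)` …»); B. Moonen,
Yu. Zarhin, Math. Ann. 315 (1999) §2 (2.4) and Thm. (2.7) (simple abelian fivefolds of Type IV(1): `k` acts with
multiplicities `(1,4)` or `(2,3)`; «for `g = 5` we always find that `Hg(X) = Sp_D(V,φ)`», here `= U_k`).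

SETTING (complex, abstract). `W` a complex vector space; `𝔊 ⊆ End(W)` a `ℂ`-subspace closed under the commutator;
`Θ ∈ 𝔊` an involution (`Θ² = 1`; in the application `Θ|_W` for `W = ker(φ_ℂ − μ)`, `+1` on `W^{1,0}`, `−1` on `W^{0,1}`)
with eigenspaces `P = {Θ = 1}`, `Q = {Θ = −1}`; a RAISING operator `B ∈ 𝔊` (`ΘB = B = −BΘ`: `B(P) = 0`, `B(W) ⊆ P`) and
a LOWERING operator `C ∈ 𝔊` (`ΘC = −C = −CΘ`).

WHAT IS PROVED.
* §1 (identities) `UnitaryThetaCore.mul_self_eq_zero_of_raise/lower` (`B² = 0 = C²`), `iter_mem` (`B(CB)^k ∈ 𝔊`, by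
  `[[B,C], B(CB)^k] = 2B(CB)^{k+1}`), `mul_pow_mul` (`B(CB)^kC = (BC)^{k+1}`), `pow_sub_pow_mem`
  (`(BC)^{k+1} − (CB)^{k+1} = [B(CB)^k, C] ∈ 𝔊`), **`aeval_sub_aeval_mem`** (`p(BC) − p(CB) ∈ 𝔊` for every polynomial `p`),
  `mul_aeval_eq` (`(CB)·p(CB) = C·p(BC)·B`).
* §2 **`UnitaryThetaCore.exists_rankOne_idempotent`** — THE HEART: if moreover `1 ∈ 𝔊`, `dim Q = dim P + 1` and
  `BC|_P` is injective, then `𝔊` contains a RANK-ONE IDEMPOTENT `u ⊗ φ` (`φ(u) = 1`). Construction: `χ` = characteristic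
  polynomial of `BC|_P` (Cayley–Hamilton `χ(BC)|_P = 0`, `δ = χ(0) ≠ 0`); then `χ(BC) = δ·(1−Θ)/2` on `W` (it is `δ` on `Q`
  because `C(Q) = 0`), so `χ(CB) = χ(BC) − (χ(BC) − χ(CB)) ∈ 𝔊` and **`E := δ⁻¹χ(CB) − (1+Θ)/2 ∈ 𝔊`**; `E` vanishes on `P`
  (`CB` kills `P`, `χ(CB)|_P = δ`), maps `Q` into `K := Q ∩ ker(CB)` (`(CB)χ(CB) = Cχ(BC)B` and `B(Q) ⊆ P`), and is the
  identity on `K`; finally `Q = K ⊕ C(P)` (for `q ∈ Q` pick `p ∈ P` with `BCp = Bq`), `dim C(P) = dim P`, so `dim K = 1` and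
  `E = u ⊗ φ`. This is exactly where `dim Q = dim P + 1` (coprimality `(a, a+1)`) enters; for `dim Q = dim P` the same
  `E` is `0` (Weil type `(2,2)`: `𝔰𝔩₂ ⊗ 1 + 1 ⊗ 𝔰𝔩₂` IS a proper irreducible `Θ`-subalgebra).
* §3 (appended) the `Θ`-grading of `𝔊` (`UnitaryThetaCore.raise_relations`, `lower_relations`, `decomp`) and the COVERING
  FACTS of an irreducible `𝔊`: **`UnitaryThetaCore.mem_span_raise_apply`** (the values of the raising operators of `𝔊`
  span `P`: `V₀ ⊕ Q` is `𝔊`-stable) and **`UnitaryThetaCore.eq_zero_of_forall_raise_apply_eq_zero`** (no non-zero vector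
  of `Q` is killed by all raising operators: that joint kernel is `𝔊`-stable); the symmetric facts for lowering
  operators are the same theorems for `−Θ`.
* §4 (appended) **`UnitaryThetaCore.eq_top_of_fullRank_pair`**: `𝔊 = End(W)` as soon as `W` is `𝔊`-irreducible and a
  full-rank pair exists (§2 with the tree's rank-one criterion `SymplecticThetaSix.eq_top_of_rankOne_idempotent`).
* §5 (appended) **`UnitaryThetaCore.apply_mem_span_of_pencil`** (THE PENCIL LEMMA: a family of operators closed
  under addition, all non-injective on a plane `P`, without common kernel vector in `P`, maps `P` into ONE line),
  **`UnitaryThetaCore.exists_lower_injOn`** (an irreducible `𝔊` has a lowering operator injective on `P`, `dim P = 2`,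
  `dim Q ≥ 2`), **`UnitaryThetaCore.exists_fullRank_pair`** (dimensions `(2,3)`: a raising `B` and a lowering `C`
  with `BC|_P` injective — pencil lemma for the families `{B·(C + tC')}`, `C + tC'` injective for all but one `t ≠ 0`,
  the raising operators with values on the line `ℓ` kill `C(P)`, and a kernel vector of `B₀C|_P` would be killed by
  every raising operator), and the MAIN THEOREM **`UnitaryThetaCore.eq_top_two_three`**: a bracket-closed
  `𝔊 ∋ 1, Θ` with `Θ`-eigenspaces of dimensions `2` and `3`, acting irreducibly, is `End(W)` — classification-free,
  replacing Serre's Prop. 5 at `(n′, n″) = (2,3)` (for `(3,2)` use `−Θ`); **`exists_rankOne_idempotent'`** and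
  **`eq_top_two_three'`** (appended) drop the hypothesis `1 ∈ 𝔊`: the idempotent is `E = −Θ − δ⁻¹(χ(BC) − χ(CB))`,
  and `𝔊 + ℂ1 = End(W)` with `E ∈ 𝔊` gives `1 ∈ 𝔊` (a rank-one idempotent and all commutators generate `1`).
SEQUEL (not in this file): with the descent of `HodgeThetaSubalgebraUnitary` §§1, 3, 4 (`V_ℂ = W ⊕ W'`,
`UnitaryTheta.eq_bot_or_eq_of_stable`, duality) this gives THEOREM L″ — `Lie Hg = 𝔲_k` and divisoriality of the Hodge
classes on all powers — for simple abelian fivefolds of type IV(1) with multiplicities `(2,3)` (shape (S2) of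
`Summit.HodgeConjecture.Ring2.FivefoldFactTwoShapes`).

## References
* [Ribet1983] K. A. Ribet, *Hodge classes on certain types of abelian varieties*, Amer. J. Math. 105 (1983), Thm. 3.
* [Gordon1997] B. B. Gordon, *A survey of the Hodge conjecture for abelian varieties*, Thm. 6.3.3 and pp. 18–19.
* [MoonenZarhin1999LowDim] B. Moonen, Yu. Zarhin, Math. Ann. 315 (1999), §2 (2.4) and Thm. (2.7).
* [GoodmanWallachGTM255] R. Goodman, N. Wallach, *Symmetry, Representations, and Invariants*, §4.1.1 (gradings).
* [Humphreys1972] J. E. Humphreys, *Introduction to Lie Algebras and Representation Theory*, §19.1.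
-/

noncomputable section

open Module Polynomial

namespace Literature.AlgebraicGeometry.Motives

namespace HodgeStructure

/-! ### §1 Identities for a raising/lowering pair -/

section Identities

variable {W : Type*} [AddCommGroup W] [Module ℂ W]

/-- A raising operator squares to zero: `ΘB = B`, `BΘ = −B` give `B² = B(ΘB) = (BΘ)B = −B²`.
[cite: GoodmanWallachGTM255, §4.1.1] -/
theorem UnitaryThetaCore.mul_self_eq_zero_of_raise {Θ B : Module.End ℂ W} (hΘB : Θ * B = B) (hBΘ : B * Θ = -B) :
    B * B = 0 := by
  have h : B * B = -(B * B) := by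
    calc B * B = B * (Θ * B) := by rw [hΘB]
      _ = (B * Θ) * B := by rw [mul_assoc]
      _ = -(B * B) := by rw [hBΘ, neg_mul]
  have h2 : (2 : ℂ) • (B * B) = 0 := by
    rw [two_smul]; nth_rewrite 2 [h]; rw [add_neg_cancel]
  exact (smul_eq_zero.1 h2).resolve_left two_ne_zero

/-- A lowering operator squares to zero: `ΘC = −C`, `CΘ = C`. [cite: GoodmanWallachGTM255, §4.1.1] -/
theorem UnitaryThetaCore.mul_self_eq_zero_of_lower {Θ C : Module.End ℂ W} (hΘC : Θ * C = -C) (hCΘ : C * Θ = C) :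
    C * C = 0 := by
  have h : C * C = -(C * C) := by
    calc C * C = (C * Θ) * C := by rw [hCΘ]
      _ = C * (Θ * C) := by rw [mul_assoc]
      _ = -(C * C) := by rw [hΘC, mul_neg]
  have h2 : (2 : ℂ) • (C * C) = 0 := by
    rw [two_smul]; nth_rewrite 2 [h]; rw [add_neg_cancel]
  exact (smul_eq_zero.1 h2).resolve_left two_ne_zero

/-- `B (CB)^k B = 0` when `B² = 0`. [cite: GoodmanWallachGTM255, §4.1.1] -/
theorem UnitaryThetaCore.mul_pow_mul_self_eq_zero {B C : Module.End ℂ W} (hBB : B * B = 0) (k : ℕ) :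
    B * (C * B) ^ k * B = 0 := by
  cases k with
  | zero => rw [pow_zero, mul_one, hBB]
  | succ k =>
    rw [pow_succ, show B * ((C * B) ^ k * (C * B)) * B = B * (C * B) ^ k * C * (B * B) by noncomm_ring, hBB,
      mul_zero]

/-- `B (CB)^k C = (BC)^{k+1}`. [cite: GoodmanWallachGTM255, §4.1.1] -/
theorem UnitaryThetaCore.mul_pow_mul (B C : Module.End ℂ W) (k : ℕ) : B * (C * B) ^ k * C = (B * C) ^ (k + 1) := by
  induction k with
  | zero => rw [pow_zero, mul_one, zero_add, pow_one]
  | succ k ih =>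
    rw [pow_succ, show B * ((C * B) ^ k * (C * B)) * C = (B * (C * B) ^ k * C) * (B * C) by noncomm_ring, ih,
      ← pow_succ]

/-- **The iterated raising operators `B(CB)^k` lie in `𝔊`**: `[[B,C], B(CB)^k] = 2·B(CB)^{k+1}` (`B² = 0`).
[cite: GoodmanWallachGTM255, §4.1.1] [cite: Gordon1997, §6 (proof of Thm. 6.3.3)] -/
theorem UnitaryThetaCore.iter_mem {𝔊 : Submodule ℂ (Module.End ℂ W)}
    (hbr : ∀ Y ∈ 𝔊, ∀ Z ∈ 𝔊, Y * Z - Z * Y ∈ 𝔊) {B C : Module.End ℂ W} (hB : B ∈ 𝔊) (hC : C ∈ 𝔊)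
    (hBB : B * B = 0) (k : ℕ) : B * (C * B) ^ k ∈ 𝔊 := by
  induction k with
  | zero => simpa using hB
  | succ k ih =>
    have hY : B * C - C * B ∈ 𝔊 := hbr B hB C hC
    have h := hbr _ hY _ ih
    have h1 : C * B * (B * (C * B) ^ k) = 0 := by
      rw [show C * B * (B * (C * B) ^ k) = C * (B * B) * (C * B) ^ k by noncomm_ring, hBB, mul_zero, zero_mul]
    have h2 : B * (C * B) ^ k * (B * C) = 0 := by
      rw [show B * (C * B) ^ k * (B * C) = (B * (C * B) ^ k * B) * C by noncomm_ring,
        UnitaryThetaCore.mul_pow_mul_self_eq_zero hBB k, zero_mul]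
    have hid : (B * C - C * B) * (B * (C * B) ^ k) - B * (C * B) ^ k * (B * C - C * B) =
        (2 : ℂ) • (B * (C * B) ^ (k + 1)) := by
      rw [sub_mul, mul_sub, h1, h2, show B * C * (B * (C * B) ^ k) = B * ((C * B) * (C * B) ^ k) by noncomm_ring,
        ← pow_succ', show B * (C * B) ^ k * (C * B) = B * ((C * B) ^ k * (C * B)) by noncomm_ring, ← pow_succ,
        two_smul]
      abel
    rw [hid] at h
    exact (Submodule.smul_mem_iff _ two_ne_zero).1 h

/-- **`(BC)^{k+1} − (CB)^{k+1} = [B(CB)^k, C] ∈ 𝔊`.** [cite: GoodmanWallachGTM255, §4.1.1] [cite: Gordon1997, §6] -/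
theorem UnitaryThetaCore.pow_sub_pow_mem {𝔊 : Submodule ℂ (Module.End ℂ W)}
    (hbr : ∀ Y ∈ 𝔊, ∀ Z ∈ 𝔊, Y * Z - Z * Y ∈ 𝔊) {B C : Module.End ℂ W} (hB : B ∈ 𝔊) (hC : C ∈ 𝔊)
    (hBB : B * B = 0) (k : ℕ) : (B * C) ^ (k + 1) - (C * B) ^ (k + 1) ∈ 𝔊 := by
  have h := hbr _ (UnitaryThetaCore.iter_mem hbr hB hC hBB k) C hC
  have hid : B * (C * B) ^ k * C - C * (B * (C * B) ^ k) = (B * C) ^ (k + 1) - (C * B) ^ (k + 1) := by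
    rw [UnitaryThetaCore.mul_pow_mul, show C * (B * (C * B) ^ k) = (C * B) * (C * B) ^ k by noncomm_ring,
      ← pow_succ']
  rwa [hid] at h

/-- **`p(BC) − p(CB) ∈ 𝔊` for every polynomial `p`** (the constant terms cancel). [cite: Gordon1997, §6] -/
theorem UnitaryThetaCore.aeval_sub_aeval_mem {𝔊 : Submodule ℂ (Module.End ℂ W)}
    (hbr : ∀ Y ∈ 𝔊, ∀ Z ∈ 𝔊, Y * Z - Z * Y ∈ 𝔊) {B C : Module.End ℂ W} (hB : B ∈ 𝔊) (hC : C ∈ 𝔊)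
    (hBB : B * B = 0) (p : ℂ[X]) : aeval (B * C) p - aeval (C * B) p ∈ 𝔊 := by
  induction p using Polynomial.induction_on' with
  | add p q hp hq =>
    have := Submodule.add_mem _ hp hq
    rwa [map_add, map_add, add_sub_add_comm]
  | monomial k c =>
    rw [aeval_monomial, aeval_monomial, ← mul_sub, Algebra.algebraMap_eq_smul_one, smul_mul_assoc, one_mul]
    refine Submodule.smul_mem _ c ?_
    cases k with
    | zero => rw [pow_zero, pow_zero, sub_self]; exact Submodule.zero_mem _
    | succ k => exact UnitaryThetaCore.pow_sub_pow_mem hbr hB hC hBB k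

/-- **Intertwining**: `(CB)·p(CB) = C·p(BC)·B`. [cite: GoodmanWallachGTM255, §4.1.1] -/
theorem UnitaryThetaCore.mul_aeval_eq (B C : Module.End ℂ W) (p : ℂ[X]) :
    C * B * aeval (C * B) p = C * aeval (B * C) p * B := by
  induction p using Polynomial.induction_on' with
  | add p q hp hq => rw [map_add, map_add, mul_add, hp, hq, mul_add, add_mul]
  | monomial k c =>
    rw [aeval_monomial, aeval_monomial, Algebra.algebraMap_eq_smul_one, smul_mul_assoc, one_mul, smul_mul_assoc,
      one_mul]
    simp only [mul_smul_comm, smul_mul_assoc]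
    congr 1
    rw [UnitaryThetaCore.mul_pow_mul C B k, pow_succ']

/-- If `g v = 0` then `p(g) v = p(0)·v`. [cite: GoodmanWallachGTM255, §4.1.1] -/
theorem UnitaryThetaCore.aeval_apply_of_apply_eq_zero (g : Module.End ℂ W) (p : ℂ[X]) {v : W} (hv : g v = 0) :
    aeval g p v = p.coeff 0 • v := by
  induction p using Polynomial.induction_on' with
  | add p q hp hq => rw [map_add, LinearMap.add_apply, hp, hq, coeff_add, add_smul]
  | monomial k c =>
    rw [aeval_monomial, Algebra.algebraMap_eq_smul_one, smul_mul_assoc, one_mul, LinearMap.smul_apply,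
      coeff_monomial]
    cases k with
    | zero => rw [pow_zero, Module.End.one_apply, if_pos rfl]
    | succ k => rw [pow_succ, Module.End.mul_apply, hv, map_zero, smul_zero, if_neg (Nat.succ_ne_zero k), zero_smul]

/-- If `T` commutes with `g` then `T` commutes with `p(g)`. [cite: GoodmanWallachGTM255, §4.1.1] -/
theorem UnitaryThetaCore.commute_aeval {T g : Module.End ℂ W} (h : T * g = g * T) (p : ℂ[X]) :
    T * aeval g p = aeval g p * T := by
  induction p using Polynomial.induction_on' with
  | add p q hp hq => rw [map_add, mul_add, add_mul, hp, hq]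
  | monomial k c =>
    rw [aeval_monomial, Algebra.algebraMap_eq_smul_one, smul_mul_assoc, one_mul, mul_smul_comm, smul_mul_assoc]
    congr 1
    induction k with
    | zero => rw [pow_zero, mul_one, one_mul]
    | succ k ih => rw [pow_succ, ← mul_assoc, ih, mul_assoc, h, ← mul_assoc]

/-- The restriction of `g` to an invariant subspace evaluates polynomials compatibly. [cite: GoodmanWallachGTM255, §4.1.1] -/
theorem UnitaryThetaCore.aeval_restrict_coe {g : Module.End ℂ W} {P : Submodule ℂ W} (hg : ∀ x ∈ P, g x ∈ P)
    (p : ℂ[X]) (x : P) : ((aeval (g.restrict hg) p) x : W) = aeval g p x := by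
  induction p using Polynomial.induction_on' with
  | add p q hp hq => rw [map_add, map_add, LinearMap.add_apply, LinearMap.add_apply, Submodule.coe_add, hp, hq]
  | monomial k c =>
    rw [aeval_monomial, aeval_monomial, Algebra.algebraMap_eq_smul_one, Algebra.algebraMap_eq_smul_one,
      smul_mul_assoc, smul_mul_assoc, one_mul, one_mul, LinearMap.smul_apply, LinearMap.smul_apply,
      Submodule.coe_smul]
    congr 1
    induction k generalizing x with
    | zero => rw [pow_zero, pow_zero, Module.End.one_apply, Module.End.one_apply]
    | succ k ih => rw [pow_succ, pow_succ, Module.End.mul_apply, Module.End.mul_apply, ih, LinearMap.coe_restrict_apply]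

end Identities

/-! ### §2 The rank-one idempotent of a full-rank pair -/

section RankOne

variable {W : Type*} [AddCommGroup W] [Module ℂ W]

/-- **THE HEART (multiplicities `(a, a+1)`): a full-rank raising/lowering pair produces a rank-one idempotent in `𝔊`.**
Let `𝔊 ∋ 1, Θ` (`Θ² = 1`) be bracket-closed, `P = {Θ = 1}`, `Q = {Θ = −1}` with `dim Q = dim P + 1`, `B ∈ 𝔊` raising,
`C ∈ 𝔊` lowering, and `BC` injective on `P`. Then `𝔊` contains `u ⊗ φ` with `φ(u) = 1`
(`E = δ⁻¹χ(CB) − (1+Θ)/2`, `χ` the characteristic polynomial of `BC|_P`, module docstring §2).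
[cite: Ribet1983, Thm. 3] [cite: Gordon1997, Thm. 6.3.3 and pp. 18–19] [cite: MoonenZarhin1999LowDim, §2 (2.4)] -/
theorem UnitaryThetaCore.exists_rankOne_idempotent [FiniteDimensional ℂ W] {𝔊 : Submodule ℂ (Module.End ℂ W)}
    (hbr : ∀ Y ∈ 𝔊, ∀ Z ∈ 𝔊, Y * Z - Z * Y ∈ 𝔊) (h1 : (1 : Module.End ℂ W) ∈ 𝔊)
    {Θ : Module.End ℂ W} (hΘ : Θ ∈ 𝔊) (hΘΘ : Θ * Θ = 1)
    {P Q : Submodule ℂ W} (hP : ∀ x, x ∈ P ↔ Θ x = x) (hQ : ∀ x, x ∈ Q ↔ Θ x = -x)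
    (hPQ : Module.finrank ℂ Q = Module.finrank ℂ P + 1)
    {B C : Module.End ℂ W} (hB : B ∈ 𝔊) (hC : C ∈ 𝔊) (hΘB : Θ * B = B) (hBΘ : B * Θ = -B)
    (hΘC : Θ * C = -C) (hCΘ : C * Θ = C) (hinj : ∀ p ∈ P, B (C p) = 0 → p = 0) :
    ∃ (u : W) (φ : Module.Dual ℂ W), φ u = 1 ∧ φ.smulRight u ∈ 𝔊 := by
  classical
  -- pointwise facts
  have hΘΘv : ∀ v, Θ (Θ v) = v := fun v => by rw [← Module.End.mul_apply, hΘΘ, Module.End.one_apply]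
  have hBB : B * B = 0 := UnitaryThetaCore.mul_self_eq_zero_of_raise hΘB hBΘ
  have hBP : ∀ p ∈ P, B p = 0 := fun p hp => by
    have h : B p = -(B p) := by
      conv_lhs => rw [← (hP p).1 hp]
      rw [← Module.End.mul_apply, hBΘ, LinearMap.neg_apply]
    have h2 : (2 : ℂ) • B p = 0 := by rw [two_smul]; nth_rewrite 2 [h]; rw [add_neg_cancel]
    exact (smul_eq_zero.1 h2).resolve_left two_ne_zero
  have hCQ : ∀ q ∈ Q, C q = 0 := fun q hq => by
    have h : C q = -(C q) := by
      conv_lhs => rw [← neg_neg q, ← (hQ q).1 hq, map_neg, ← Module.End.mul_apply, hCΘ]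
    have h2 : (2 : ℂ) • C q = 0 := by rw [two_smul]; nth_rewrite 2 [h]; rw [add_neg_cancel]
    exact (smul_eq_zero.1 h2).resolve_left two_ne_zero
  have hBmem : ∀ w, B w ∈ P := fun w => (hP _).2 (by rw [← Module.End.mul_apply, hΘB])
  have hCmem : ∀ w, C w ∈ Q := fun w => (hQ _).2 (by rw [← Module.End.mul_apply, hΘC, LinearMap.neg_apply])
  -- the decomposition `w = P̂ w + Q̂ w`
  have hPhat : ∀ w, (2 : ℂ)⁻¹ • (w + Θ w) ∈ P := fun w =>
    (hP _).2 (by rw [map_smul, map_add, hΘΘv, add_comm])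
  have hQhat : ∀ w, (2 : ℂ)⁻¹ • (w - Θ w) ∈ Q := fun w =>
    (hQ _).2 (by rw [map_smul, map_sub, hΘΘv, ← smul_neg, neg_sub])
  have hsplit : ∀ w, (2 : ℂ)⁻¹ • (w + Θ w) + (2 : ℂ)⁻¹ • (w - Θ w) = w := fun w => by module
  -- the restricted operator `f = BC|_P`, its characteristic polynomial
  have hf : ∀ x ∈ P, (B * C) x ∈ P := fun x _ => hBmem _
  set f : Module.End ℂ P := (B * C).restrict hf with hfdef
  have hfinj : Function.Injective f := by
    intro x y hxy
    apply Subtype.ext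
    have h : ((f x : P) : W) = (f y : W) := by rw [hxy]
    rw [hfdef, LinearMap.coe_restrict_apply, LinearMap.coe_restrict_apply, Module.End.mul_apply,
      Module.End.mul_apply, ← sub_eq_zero, ← map_sub, ← map_sub] at h
    exact sub_eq_zero.1 (hinj _ (Submodule.sub_mem _ x.2 y.2) h)
  have hfunit : IsUnit f := (LinearMap.isUnit_iff_ker_eq_bot f).2 (LinearMap.ker_eq_bot.2 hfinj)
  set χ : ℂ[X] := f.charpoly with hχdef
  set δ : ℂ := χ.coeff 0 with hδdef
  have hδ : δ ≠ 0 := by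
    intro h0
    have hdet : LinearMap.det f = 0 := by
      rw [LinearMap.det_eq_sign_charpoly_coeff, ← hχdef, ← hδdef, h0, mul_zero]
    have hu := (LinearMap.isUnit_iff_isUnit_det f).1 hfunit
    rw [hdet] at hu
    exact not_isUnit_zero hu
  -- Cayley–Hamilton on `P`
  have hCH : ∀ p ∈ P, aeval (B * C) χ p = 0 := fun p hp => by
    have h := UnitaryThetaCore.aeval_restrict_coe hf χ ⟨p, hp⟩
    rw [hχdef, LinearMap.aeval_self_charpoly, LinearMap.zero_apply, Submodule.coe_zero] at h
    rw [hχdef, ← h]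
  -- `χ(BC) = δ · Q̂` on `W`
  have hBCQ : ∀ q ∈ Q, (B * C) q = 0 := fun q hq => by rw [Module.End.mul_apply, hCQ q hq, map_zero]
  have hCBP : ∀ p ∈ P, (C * B) p = 0 := fun p hp => by rw [Module.End.mul_apply, hBP p hp, map_zero]
  have haevalBC : aeval (B * C) χ = δ • ((2 : ℂ)⁻¹ • ((1 : Module.End ℂ W) - Θ)) := by
    refine LinearMap.ext fun w => ?_
    conv_lhs => rw [← hsplit w]
    rw [map_add, hCH _ (hPhat w), zero_add, UnitaryThetaCore.aeval_apply_of_apply_eq_zero _ _ (hBCQ _ (hQhat w))]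
    simp only [LinearMap.smul_apply, LinearMap.sub_apply, Module.End.one_apply, hδdef]
  have haevalBCmem : aeval (B * C) χ ∈ 𝔊 := by
    rw [haevalBC]
    exact Submodule.smul_mem _ _ (Submodule.smul_mem _ _ (Submodule.sub_mem _ h1 hΘ))
  have haevalCBmem : aeval (C * B) χ ∈ 𝔊 := by
    have h := Submodule.sub_mem _ haevalBCmem (UnitaryThetaCore.aeval_sub_aeval_mem hbr hB hC hBB χ)
    rwa [sub_sub_cancel] at h
  -- the element `E`
  set E : Module.End ℂ W := δ⁻¹ • aeval (C * B) χ - (2 : ℂ)⁻¹ • (1 + Θ) with hEdef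
  have hEmem : E ∈ 𝔊 :=
    Submodule.sub_mem _ (Submodule.smul_mem _ _ haevalCBmem) (Submodule.smul_mem _ _ (Submodule.add_mem _ h1 hΘ))
  have hEP : ∀ p ∈ P, E p = 0 := fun p hp => by
    rw [hEdef, LinearMap.sub_apply, LinearMap.smul_apply,
      UnitaryThetaCore.aeval_apply_of_apply_eq_zero _ _ (hCBP p hp), ← hδdef, smul_smul, inv_mul_cancel₀ hδ,
      one_smul, LinearMap.smul_apply, LinearMap.add_apply, Module.End.one_apply, (hP p).1 hp]
    module
  have hEQ : ∀ q ∈ Q, E q = δ⁻¹ • aeval (C * B) χ q := fun q hq => by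
    rw [hEdef, LinearMap.sub_apply, LinearMap.smul_apply, LinearMap.smul_apply, LinearMap.add_apply,
      Module.End.one_apply, (hQ q).1 hq, add_neg_cancel, smul_zero, sub_zero]
  -- `K = Q ∩ ker(CB)`; `E` maps `W` into `K` and is the identity on `K`
  set K : Submodule ℂ W := Q ⊓ LinearMap.ker (C * B) with hKdef
  have hΘCB : Θ * (C * B) = C * B * Θ := by
    rw [← mul_assoc, hΘC, mul_assoc, hBΘ, neg_mul, mul_neg]
  have hEQmem : ∀ q ∈ Q, E q ∈ K := fun q hq => by
    rw [hEQ q hq]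
    refine Submodule.smul_mem _ _ (Submodule.mem_inf.2 ⟨(hQ _).2 ?_, LinearMap.mem_ker.2 ?_⟩)
    · rw [← Module.End.mul_apply, UnitaryThetaCore.commute_aeval hΘCB, Module.End.mul_apply, (hQ q).1 hq, map_neg]
    · rw [← Module.End.mul_apply, UnitaryThetaCore.mul_aeval_eq, Module.End.mul_apply,
        Module.End.mul_apply, hCH _ (hBmem q), map_zero]
  have hEW : ∀ w, E w ∈ K := fun w => by
    rw [← hsplit w, map_add, hEP _ (hPhat w), zero_add]
    exact hEQmem _ (hQhat w)
  have hEK : ∀ u ∈ K, E u = u := fun u hu => by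
    have hu' := Submodule.mem_inf.1 hu
    rw [hEQ u hu'.1, UnitaryThetaCore.aeval_apply_of_apply_eq_zero _ _ (LinearMap.mem_ker.1 hu'.2), ← hδdef,
      smul_smul, inv_mul_cancel₀ hδ, one_smul]
  -- `dim K = 1`: `Q = K ⊕ C(P)` and `dim C(P) = dim P`
  have hCinj : ∀ p ∈ P, C p = 0 → p = 0 := fun p hp h0 => hinj p hp (by rw [h0, map_zero])
  set g : P →ₗ[ℂ] W := C ∘ₗ P.subtype with hgdef
  have hginj : Function.Injective g := by
    intro x y hxy
    apply Subtype.ext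
    have h : C (x - y : P) = 0 := by
      rw [Submodule.coe_sub, map_sub]; exact sub_eq_zero.2 hxy
    exact sub_eq_zero.1 (by exact_mod_cast hCinj _ (x - y).2 h)
  have hrange : LinearMap.range g = P.map C := by
    rw [hgdef, LinearMap.range_comp, Submodule.range_subtype]
  have hfin_map : Module.finrank ℂ (P.map C) = Module.finrank ℂ P := by
    rw [← hrange, LinearMap.finrank_range_of_inj hginj]
  have hsup : K ⊔ P.map C = Q := by
    apply le_antisymm
    · refine sup_le (fun x hx => hx.1) ?_
      rintro _ ⟨p, -, rfl⟩
      exact hCmem p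
    · intro q hq
      -- `p ∈ P` with `BCp = Bq`
      obtain ⟨p', hp'⟩ := (LinearMap.injective_iff_surjective.1 hfinj) ⟨B q, hBmem q⟩
      have hp'W : B (C (p' : W)) = B q := by
        have h := congrArg Subtype.val hp'
        rw [hfdef, LinearMap.coe_restrict_apply, Module.End.mul_apply] at h
        exact h
      have hsplitq : q = (q - C p') + C p' := by abel
      rw [hsplitq]
      refine Submodule.add_mem _ (Submodule.mem_sup_left (Submodule.mem_inf.2
        ⟨Submodule.sub_mem _ hq (hCmem _), LinearMap.mem_ker.2 ?_⟩)) (Submodule.mem_sup_right ⟨p', p'.2, rfl⟩)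
      rw [Module.End.mul_apply, map_sub, hp'W, sub_self, map_zero]
  have hinf : K ⊓ P.map C = ⊥ := by
    rw [eq_bot_iff]
    rintro x ⟨hxK, ⟨p, hp, rfl⟩⟩
    rw [Submodule.mem_bot]
    have h1' : B (C p) = 0 := by
      have hk : C (B (C p)) = 0 := by
        have h := LinearMap.mem_ker.1 (Submodule.mem_inf.1 hxK).2
        rwa [Module.End.mul_apply] at h
      exact hCinj _ (hBmem _) hk
    rw [hinj p hp h1', map_zero]
  have hdimK : Module.finrank ℂ K = 1 := by
    have h := Submodule.finrank_sup_add_finrank_inf_eq K (P.map C)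
    rw [hsup, hinf, finrank_bot, add_zero, hfin_map, hPQ] at h
    omega
  -- a generator `u` of `K`
  obtain ⟨u, huK, hu0⟩ : ∃ u ∈ K, u ≠ 0 := by
    by_contra hne
    push Not at hne
    have hKbot : K = ⊥ := by
      rw [eq_bot_iff]; intro x hx; rw [Submodule.mem_bot]; exact hne x hx
    rw [hKbot, finrank_bot] at hdimK
    exact zero_ne_one hdimK
  have hline : ∀ x ∈ K, ∃ c : ℂ, c • u = x := fun x hx => by
    have hu0' : (⟨u, huK⟩ : K) ≠ 0 := fun h => hu0 (congrArg Subtype.val h)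
    obtain ⟨c, hc⟩ := (finrank_eq_one_iff_of_nonzero' (⟨u, huK⟩ : K) hu0').1 hdimK ⟨x, hx⟩
    exact ⟨c, by simpa using congrArg Subtype.val hc⟩
  -- the functional
  obtain ⟨ψ, hψ⟩ := Module.Projective.exists_dual_eq_one ℂ hu0
  refine ⟨u, ψ ∘ₗ E, ?_, ?_⟩
  · rw [LinearMap.comp_apply, hEK u huK, hψ]
  · have hE : (ψ ∘ₗ E).smulRight u = E := by
      refine LinearMap.ext fun w => ?_
      obtain ⟨c, hc⟩ := hline _ (hEW w)
      rw [LinearMap.smulRight_apply, LinearMap.comp_apply, ← hc, map_smul, hψ, smul_eq_mul, mul_one]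
    rw [hE]
    exact hEmem

/-- **THE HEART without `1 ∈ 𝔊` (appended)**: the same rank-one idempotent is `E = −Θ − δ⁻¹(χ(BC) − χ(CB)) ∈ 𝔊`,
so the hypothesis `1 ∈ 𝔊` of `exists_rankOne_idempotent` is superfluous.
Let `𝔊 ∋ 1, Θ` (`Θ² = 1`) be bracket-closed, `P = {Θ = 1}`, `Q = {Θ = −1}` with `dim Q = dim P + 1`, `B ∈ 𝔊` raising,
`C ∈ 𝔊` lowering, and `BC` injective on `P`. Then `𝔊` contains `u ⊗ φ` with `φ(u) = 1`
(`E = δ⁻¹χ(CB) − (1+Θ)/2`, `χ` the characteristic polynomial of `BC|_P`, module docstring §2).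
[cite: Ribet1983, Thm. 3] [cite: Gordon1997, Thm. 6.3.3 and pp. 18–19] [cite: MoonenZarhin1999LowDim, §2 (2.4)] -/
theorem UnitaryThetaCore.exists_rankOne_idempotent' [FiniteDimensional ℂ W] {𝔊 : Submodule ℂ (Module.End ℂ W)}
    (hbr : ∀ Y ∈ 𝔊, ∀ Z ∈ 𝔊, Y * Z - Z * Y ∈ 𝔊)
    {Θ : Module.End ℂ W} (hΘ : Θ ∈ 𝔊) (hΘΘ : Θ * Θ = 1)
    {P Q : Submodule ℂ W} (hP : ∀ x, x ∈ P ↔ Θ x = x) (hQ : ∀ x, x ∈ Q ↔ Θ x = -x)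
    (hPQ : Module.finrank ℂ Q = Module.finrank ℂ P + 1)
    {B C : Module.End ℂ W} (hB : B ∈ 𝔊) (hC : C ∈ 𝔊) (hΘB : Θ * B = B) (hBΘ : B * Θ = -B)
    (hΘC : Θ * C = -C) (hCΘ : C * Θ = C) (hinj : ∀ p ∈ P, B (C p) = 0 → p = 0) :
    ∃ (u : W) (φ : Module.Dual ℂ W), φ u = 1 ∧ φ.smulRight u ∈ 𝔊 := by
  classical
  -- pointwise facts
  have hΘΘv : ∀ v, Θ (Θ v) = v := fun v => by rw [← Module.End.mul_apply, hΘΘ, Module.End.one_apply]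
  have hBB : B * B = 0 := UnitaryThetaCore.mul_self_eq_zero_of_raise hΘB hBΘ
  have hBP : ∀ p ∈ P, B p = 0 := fun p hp => by
    have h : B p = -(B p) := by
      conv_lhs => rw [← (hP p).1 hp]
      rw [← Module.End.mul_apply, hBΘ, LinearMap.neg_apply]
    have h2 : (2 : ℂ) • B p = 0 := by rw [two_smul]; nth_rewrite 2 [h]; rw [add_neg_cancel]
    exact (smul_eq_zero.1 h2).resolve_left two_ne_zero
  have hCQ : ∀ q ∈ Q, C q = 0 := fun q hq => by
    have h : C q = -(C q) := by
      conv_lhs => rw [← neg_neg q, ← (hQ q).1 hq, map_neg, ← Module.End.mul_apply, hCΘ]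
    have h2 : (2 : ℂ) • C q = 0 := by rw [two_smul]; nth_rewrite 2 [h]; rw [add_neg_cancel]
    exact (smul_eq_zero.1 h2).resolve_left two_ne_zero
  have hBmem : ∀ w, B w ∈ P := fun w => (hP _).2 (by rw [← Module.End.mul_apply, hΘB])
  have hCmem : ∀ w, C w ∈ Q := fun w => (hQ _).2 (by rw [← Module.End.mul_apply, hΘC, LinearMap.neg_apply])
  -- the decomposition `w = P̂ w + Q̂ w`
  have hPhat : ∀ w, (2 : ℂ)⁻¹ • (w + Θ w) ∈ P := fun w =>
    (hP _).2 (by rw [map_smul, map_add, hΘΘv, add_comm])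
  have hQhat : ∀ w, (2 : ℂ)⁻¹ • (w - Θ w) ∈ Q := fun w =>
    (hQ _).2 (by rw [map_smul, map_sub, hΘΘv, ← smul_neg, neg_sub])
  have hsplit : ∀ w, (2 : ℂ)⁻¹ • (w + Θ w) + (2 : ℂ)⁻¹ • (w - Θ w) = w := fun w => by module
  -- the restricted operator `f = BC|_P`, its characteristic polynomial
  have hf : ∀ x ∈ P, (B * C) x ∈ P := fun x _ => hBmem _
  set f : Module.End ℂ P := (B * C).restrict hf with hfdef
  have hfinj : Function.Injective f := by
    intro x y hxy
    apply Subtype.ext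
    have h : ((f x : P) : W) = (f y : W) := by rw [hxy]
    rw [hfdef, LinearMap.coe_restrict_apply, LinearMap.coe_restrict_apply, Module.End.mul_apply,
      Module.End.mul_apply, ← sub_eq_zero, ← map_sub, ← map_sub] at h
    exact sub_eq_zero.1 (hinj _ (Submodule.sub_mem _ x.2 y.2) h)
  have hfunit : IsUnit f := (LinearMap.isUnit_iff_ker_eq_bot f).2 (LinearMap.ker_eq_bot.2 hfinj)
  set χ : ℂ[X] := f.charpoly with hχdef
  set δ : ℂ := χ.coeff 0 with hδdef
  have hδ : δ ≠ 0 := by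
    intro h0
    have hdet : LinearMap.det f = 0 := by
      rw [LinearMap.det_eq_sign_charpoly_coeff, ← hχdef, ← hδdef, h0, mul_zero]
    have hu := (LinearMap.isUnit_iff_isUnit_det f).1 hfunit
    rw [hdet] at hu
    exact not_isUnit_zero hu
  -- Cayley–Hamilton on `P`
  have hCH : ∀ p ∈ P, aeval (B * C) χ p = 0 := fun p hp => by
    have h := UnitaryThetaCore.aeval_restrict_coe hf χ ⟨p, hp⟩
    rw [hχdef, LinearMap.aeval_self_charpoly, LinearMap.zero_apply, Submodule.coe_zero] at h
    rw [hχdef, ← h]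
  -- `χ(BC) = δ · Q̂` on `W`
  have hBCQ : ∀ q ∈ Q, (B * C) q = 0 := fun q hq => by rw [Module.End.mul_apply, hCQ q hq, map_zero]
  have hCBP : ∀ p ∈ P, (C * B) p = 0 := fun p hp => by rw [Module.End.mul_apply, hBP p hp, map_zero]
  have haevalBC : aeval (B * C) χ = δ • ((2 : ℂ)⁻¹ • ((1 : Module.End ℂ W) - Θ)) := by
    refine LinearMap.ext fun w => ?_
    conv_lhs => rw [← hsplit w]
    rw [map_add, hCH _ (hPhat w), zero_add, UnitaryThetaCore.aeval_apply_of_apply_eq_zero _ _ (hBCQ _ (hQhat w))]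
    simp only [LinearMap.smul_apply, LinearMap.sub_apply, Module.End.one_apply, hδdef]
  -- the element `E = −Θ − δ⁻¹ (χ(BC) − χ(CB))`
  set E : Module.End ℂ W := δ⁻¹ • aeval (C * B) χ - (2 : ℂ)⁻¹ • (1 + Θ) with hEdef
  have hEmem : E ∈ 𝔊 := by
    have hEeq : E = -Θ - δ⁻¹ • (aeval (B * C) χ - aeval (C * B) χ) := by
      rw [hEdef, haevalBC, smul_sub, smul_smul, inv_mul_cancel₀ hδ, one_smul]
      module
    rw [hEeq]
    exact Submodule.sub_mem _ (Submodule.neg_mem _ hΘ)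
      (Submodule.smul_mem _ _ (UnitaryThetaCore.aeval_sub_aeval_mem hbr hB hC hBB χ))
  have hEP : ∀ p ∈ P, E p = 0 := fun p hp => by
    rw [hEdef, LinearMap.sub_apply, LinearMap.smul_apply,
      UnitaryThetaCore.aeval_apply_of_apply_eq_zero _ _ (hCBP p hp), ← hδdef, smul_smul, inv_mul_cancel₀ hδ,
      one_smul, LinearMap.smul_apply, LinearMap.add_apply, Module.End.one_apply, (hP p).1 hp]
    module
  have hEQ : ∀ q ∈ Q, E q = δ⁻¹ • aeval (C * B) χ q := fun q hq => by
    rw [hEdef, LinearMap.sub_apply, LinearMap.smul_apply, LinearMap.smul_apply, LinearMap.add_apply,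
      Module.End.one_apply, (hQ q).1 hq, add_neg_cancel, smul_zero, sub_zero]
  -- `K = Q ∩ ker(CB)`; `E` maps `W` into `K` and is the identity on `K`
  set K : Submodule ℂ W := Q ⊓ LinearMap.ker (C * B) with hKdef
  have hΘCB : Θ * (C * B) = C * B * Θ := by
    rw [← mul_assoc, hΘC, mul_assoc, hBΘ, neg_mul, mul_neg]
  have hEQmem : ∀ q ∈ Q, E q ∈ K := fun q hq => by
    rw [hEQ q hq]
    refine Submodule.smul_mem _ _ (Submodule.mem_inf.2 ⟨(hQ _).2 ?_, LinearMap.mem_ker.2 ?_⟩)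
    · rw [← Module.End.mul_apply, UnitaryThetaCore.commute_aeval hΘCB, Module.End.mul_apply, (hQ q).1 hq, map_neg]
    · rw [← Module.End.mul_apply, UnitaryThetaCore.mul_aeval_eq, Module.End.mul_apply,
        Module.End.mul_apply, hCH _ (hBmem q), map_zero]
  have hEW : ∀ w, E w ∈ K := fun w => by
    rw [← hsplit w, map_add, hEP _ (hPhat w), zero_add]
    exact hEQmem _ (hQhat w)
  have hEK : ∀ u ∈ K, E u = u := fun u hu => by
    have hu' := Submodule.mem_inf.1 hu
    rw [hEQ u hu'.1, UnitaryThetaCore.aeval_apply_of_apply_eq_zero _ _ (LinearMap.mem_ker.1 hu'.2), ← hδdef,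
      smul_smul, inv_mul_cancel₀ hδ, one_smul]
  -- `dim K = 1`: `Q = K ⊕ C(P)` and `dim C(P) = dim P`
  have hCinj : ∀ p ∈ P, C p = 0 → p = 0 := fun p hp h0 => hinj p hp (by rw [h0, map_zero])
  set g : P →ₗ[ℂ] W := C ∘ₗ P.subtype with hgdef
  have hginj : Function.Injective g := by
    intro x y hxy
    apply Subtype.ext
    have h : C (x - y : P) = 0 := by
      rw [Submodule.coe_sub, map_sub]; exact sub_eq_zero.2 hxy
    exact sub_eq_zero.1 (by exact_mod_cast hCinj _ (x - y).2 h)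
  have hrange : LinearMap.range g = P.map C := by
    rw [hgdef, LinearMap.range_comp, Submodule.range_subtype]
  have hfin_map : Module.finrank ℂ (P.map C) = Module.finrank ℂ P := by
    rw [← hrange, LinearMap.finrank_range_of_inj hginj]
  have hsup : K ⊔ P.map C = Q := by
    apply le_antisymm
    · refine sup_le (fun x hx => hx.1) ?_
      rintro _ ⟨p, -, rfl⟩
      exact hCmem p
    · intro q hq
      -- `p ∈ P` with `BCp = Bq`
      obtain ⟨p', hp'⟩ := (LinearMap.injective_iff_surjective.1 hfinj) ⟨B q, hBmem q⟩
      have hp'W : B (C (p' : W)) = B q := by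
        have h := congrArg Subtype.val hp'
        rw [hfdef, LinearMap.coe_restrict_apply, Module.End.mul_apply] at h
        exact h
      have hsplitq : q = (q - C p') + C p' := by abel
      rw [hsplitq]
      refine Submodule.add_mem _ (Submodule.mem_sup_left (Submodule.mem_inf.2
        ⟨Submodule.sub_mem _ hq (hCmem _), LinearMap.mem_ker.2 ?_⟩)) (Submodule.mem_sup_right ⟨p', p'.2, rfl⟩)
      rw [Module.End.mul_apply, map_sub, hp'W, sub_self, map_zero]
  have hinf : K ⊓ P.map C = ⊥ := by
    rw [eq_bot_iff]
    rintro x ⟨hxK, ⟨p, hp, rfl⟩⟩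
    rw [Submodule.mem_bot]
    have h1' : B (C p) = 0 := by
      have hk : C (B (C p)) = 0 := by
        have h := LinearMap.mem_ker.1 (Submodule.mem_inf.1 hxK).2
        rwa [Module.End.mul_apply] at h
      exact hCinj _ (hBmem _) hk
    rw [hinj p hp h1', map_zero]
  have hdimK : Module.finrank ℂ K = 1 := by
    have h := Submodule.finrank_sup_add_finrank_inf_eq K (P.map C)
    rw [hsup, hinf, finrank_bot, add_zero, hfin_map, hPQ] at h
    omega
  -- a generator `u` of `K`
  obtain ⟨u, huK, hu0⟩ : ∃ u ∈ K, u ≠ 0 := by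
    by_contra hne
    push Not at hne
    have hKbot : K = ⊥ := by
      rw [eq_bot_iff]; intro x hx; rw [Submodule.mem_bot]; exact hne x hx
    rw [hKbot, finrank_bot] at hdimK
    exact zero_ne_one hdimK
  have hline : ∀ x ∈ K, ∃ c : ℂ, c • u = x := fun x hx => by
    have hu0' : (⟨u, huK⟩ : K) ≠ 0 := fun h => hu0 (congrArg Subtype.val h)
    obtain ⟨c, hc⟩ := (finrank_eq_one_iff_of_nonzero' (⟨u, huK⟩ : K) hu0').1 hdimK ⟨x, hx⟩
    exact ⟨c, by simpa using congrArg Subtype.val hc⟩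
  -- the functional
  obtain ⟨ψ, hψ⟩ := Module.Projective.exists_dual_eq_one ℂ hu0
  refine ⟨u, ψ ∘ₗ E, ?_, ?_⟩
  · rw [LinearMap.comp_apply, hEK u huK, hψ]
  · have hE : (ψ ∘ₗ E).smulRight u = E := by
      refine LinearMap.ext fun w => ?_
      obtain ⟨c, hc⟩ := hline _ (hEW w)
      rw [LinearMap.smulRight_apply, LinearMap.comp_apply, ← hc, map_smul, hψ, smul_eq_mul, mul_one]
    rw [hE]
    exact hEmem

end RankOne

/-! ### §3 The `Θ`-grading of `𝔊` and the covering facts of an irreducible `𝔊` -/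

section Covering

variable {W : Type*} [AddCommGroup W] [Module ℂ W]

/-- The raising component `Z₊ = ¼(Z + ΘZ − ZΘ − ΘZΘ)` of `Z ∈ 𝔊` lies in `𝔊` and satisfies `ΘZ₊ = Z₊ = −Z₊Θ`
(the tree's `UnitaryTheta.raise_mem`). [cite: GoodmanWallachGTM255, §4.1.1] [cite: Gordon1997, §6 (proof of Thm. 6.3.3)] -/
theorem UnitaryThetaCore.raise_relations {𝔊 : Submodule ℂ (Module.End ℂ W)}
    (hbr : ∀ Y ∈ 𝔊, ∀ Z ∈ 𝔊, Y * Z - Z * Y ∈ 𝔊) {Θ : Module.End ℂ W} (hΘ : Θ ∈ 𝔊) (hΘΘ : Θ * Θ = 1)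
    {Z : Module.End ℂ W} (hZ : Z ∈ 𝔊) :
    (4 : ℂ)⁻¹ • (Z + Θ * Z - Z * Θ - Θ * Z * Θ) ∈ 𝔊 ∧
      Θ * ((4 : ℂ)⁻¹ • (Z + Θ * Z - Z * Θ - Θ * Z * Θ)) = (4 : ℂ)⁻¹ • (Z + Θ * Z - Z * Θ - Θ * Z * Θ) ∧
      (4 : ℂ)⁻¹ • (Z + Θ * Z - Z * Θ - Θ * Z * Θ) * Θ = -((4 : ℂ)⁻¹ • (Z + Θ * Z - Z * Θ - Θ * Z * Θ)) := by
  have hΘΘv : ∀ v, Θ (Θ v) = v := fun v => by rw [← Module.End.mul_apply, hΘΘ, Module.End.one_apply]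
  refine ⟨UnitaryTheta.raise_mem hbr hΘ hΘΘv hZ, ?_, ?_⟩
  · have h : Θ * (Z + Θ * Z - Z * Θ - Θ * Z * Θ) = Z + Θ * Z - Z * Θ - Θ * Z * Θ := by
      have e1 : Θ * (Θ * Z) = Z := by rw [← mul_assoc, hΘΘ, one_mul]
      have e2 : Θ * (Θ * Z * Θ) = Z * Θ := by rw [← mul_assoc, ← mul_assoc, hΘΘ, one_mul]
      rw [mul_sub, mul_sub, mul_add, e1, e2, ← mul_assoc]; abel
    rw [mul_smul_comm, h]
  · have h : (Z + Θ * Z - Z * Θ - Θ * Z * Θ) * Θ = -(Z + Θ * Z - Z * Θ - Θ * Z * Θ) := by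
      have e1 : Z * Θ * Θ = Z := by rw [mul_assoc, hΘΘ, mul_one]
      have e2 : Θ * Z * Θ * Θ = Θ * Z := by rw [mul_assoc, hΘΘ, mul_one]
      rw [sub_mul, sub_mul, add_mul, e1, e2]; abel
    rw [smul_mul_assoc, h, smul_neg]

/-- The lowering component `Z₋ = ¼(Z − ΘZ + ZΘ − ΘZΘ)` of `Z ∈ 𝔊` lies in `𝔊` and satisfies `ΘZ₋ = −Z₋`, `Z₋Θ = Z₋`
(raising for `−Θ`). [cite: GoodmanWallachGTM255, §4.1.1] -/
theorem UnitaryThetaCore.lower_relations {𝔊 : Submodule ℂ (Module.End ℂ W)}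
    (hbr : ∀ Y ∈ 𝔊, ∀ Z ∈ 𝔊, Y * Z - Z * Y ∈ 𝔊) {Θ : Module.End ℂ W} (hΘ : Θ ∈ 𝔊) (hΘΘ : Θ * Θ = 1)
    {Z : Module.End ℂ W} (hZ : Z ∈ 𝔊) :
    (4 : ℂ)⁻¹ • (Z - Θ * Z + Z * Θ - Θ * Z * Θ) ∈ 𝔊 ∧
      Θ * ((4 : ℂ)⁻¹ • (Z - Θ * Z + Z * Θ - Θ * Z * Θ)) = -((4 : ℂ)⁻¹ • (Z - Θ * Z + Z * Θ - Θ * Z * Θ)) ∧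
      (4 : ℂ)⁻¹ • (Z - Θ * Z + Z * Θ - Θ * Z * Θ) * Θ = (4 : ℂ)⁻¹ • (Z - Θ * Z + Z * Θ - Θ * Z * Θ) := by
  have hnΘ : -Θ ∈ 𝔊 := Submodule.neg_mem _ hΘ
  have hnΘΘ : (-Θ) * (-Θ) = 1 := by rw [neg_mul_neg, hΘΘ]
  obtain ⟨hmem, h1, h2⟩ := UnitaryThetaCore.raise_relations hbr hnΘ hnΘΘ hZ
  have he : (4 : ℂ)⁻¹ • (Z + -Θ * Z - Z * -Θ - -Θ * Z * -Θ) = (4 : ℂ)⁻¹ • (Z - Θ * Z + Z * Θ - Θ * Z * Θ) := by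
    congr 1; simp only [neg_mul, mul_neg, neg_neg]; abel
  rw [he] at hmem h1 h2
  rw [neg_mul, neg_eq_iff_eq_neg] at h1
  rw [mul_neg, neg_inj] at h2
  exact ⟨hmem, h1, h2⟩

/-- The decomposition `Z = Z₊ + Z₋ + Z₀` with `Z₀ = ½(Z + ΘZΘ)` commuting with `Θ`. [cite: GoodmanWallachGTM255, §4.1.1] -/
theorem UnitaryThetaCore.decomp {Θ : Module.End ℂ W} (hΘΘ : Θ * Θ = 1) (Z : Module.End ℂ W) :
    Z = (4 : ℂ)⁻¹ • (Z + Θ * Z - Z * Θ - Θ * Z * Θ) + (4 : ℂ)⁻¹ • (Z - Θ * Z + Z * Θ - Θ * Z * Θ) +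
        (2 : ℂ)⁻¹ • (Z + Θ * Z * Θ) ∧
      Θ * ((2 : ℂ)⁻¹ • (Z + Θ * Z * Θ)) = (2 : ℂ)⁻¹ • (Z + Θ * Z * Θ) * Θ := by
  refine ⟨by module, ?_⟩
  rw [mul_smul_comm, smul_mul_assoc, mul_add, add_mul, ← mul_assoc, ← mul_assoc, hΘΘ, one_mul,
    mul_assoc (Θ * Z) Θ Θ, hΘΘ, mul_one, add_comm]

/-- The `Θ`-commuting component `Z₀` of `Z ∈ 𝔊` lies in `𝔊` (when `Θ ∈ 𝔊`). [cite: GoodmanWallachGTM255, §4.1.1] -/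
theorem UnitaryThetaCore.zero_mem {𝔊 : Submodule ℂ (Module.End ℂ W)}
    (hbr : ∀ Y ∈ 𝔊, ∀ Z ∈ 𝔊, Y * Z - Z * Y ∈ 𝔊) {Θ : Module.End ℂ W} (hΘ : Θ ∈ 𝔊) (hΘΘ : Θ * Θ = 1)
    {Z : Module.End ℂ W} (hZ : Z ∈ 𝔊) : (2 : ℂ)⁻¹ • (Z + Θ * Z * Θ) ∈ 𝔊 := by
  have h := (UnitaryThetaCore.decomp hΘΘ Z).1
  have h' : (2 : ℂ)⁻¹ • (Z + Θ * Z * Θ) = Z - (4 : ℂ)⁻¹ • (Z + Θ * Z - Z * Θ - Θ * Z * Θ) -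
      (4 : ℂ)⁻¹ • (Z - Θ * Z + Z * Θ - Θ * Z * Θ) := by module
  rw [h']
  exact Submodule.sub_mem _ (Submodule.sub_mem _ hZ (UnitaryThetaCore.raise_relations hbr hΘ hΘΘ hZ).1)
    (UnitaryThetaCore.lower_relations hbr hΘ hΘΘ hZ).1

/-- **COVERING FACT (1a): the values of the raising operators of an irreducible `𝔊` span `P = {Θ = 1}`**
(`V₀ ⊕ Q` is `𝔊`-stable and non-zero). The symmetric fact for lowering operators and `Q` is this theorem for `−Θ`.
[cite: Gordon1997, §6 (proof of Thm. 6.3.3, p. 19)] [cite: Ribet1983, Thm. 3] -/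
theorem UnitaryThetaCore.mem_span_raise_apply {𝔊 : Submodule ℂ (Module.End ℂ W)}
    (hbr : ∀ Y ∈ 𝔊, ∀ Z ∈ 𝔊, Y * Z - Z * Y ∈ 𝔊)
    (hirr : ∀ U : Submodule ℂ W, (∀ A ∈ 𝔊, ∀ u ∈ U, A u ∈ U) → U = ⊥ ∨ U = ⊤)
    {Θ : Module.End ℂ W} (hΘ : Θ ∈ 𝔊) (hΘΘ : Θ * Θ = 1) (hQ0 : ∃ q : W, q ≠ 0 ∧ Θ q = -q)
    {y : W} (hy : Θ y = y) :
    y ∈ Submodule.span ℂ {x : W | ∃ B ∈ 𝔊, Θ * B = B ∧ B * Θ = -B ∧ ∃ w, B w = x} := by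
  classical
  have hΘΘv : ∀ v, Θ (Θ v) = v := fun v => by rw [← Module.End.mul_apply, hΘΘ, Module.End.one_apply]
  set V₀ : Submodule ℂ W := Submodule.span ℂ {x : W | ∃ B ∈ 𝔊, Θ * B = B ∧ B * Θ = -B ∧ ∃ w, B w = x} with hV₀
  set Q : Submodule ℂ W := LinearMap.ker (Θ + 1) with hQdef
  have hQmem : ∀ x, x ∈ Q ↔ Θ x = -x := fun x => by
    rw [hQdef, LinearMap.mem_ker, LinearMap.add_apply, Module.End.one_apply, add_eq_zero_iff_eq_neg]
  -- values of raising operators are `+1`-eigenvectors; `V₀ ≤ P`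
  have hV₀P : ∀ x ∈ V₀, Θ x = x := by
    intro x hx
    induction hx using Submodule.span_induction with
    | mem x hx =>
      obtain ⟨B, -, hΘB, -, w, rfl⟩ := hx
      rw [← Module.End.mul_apply, hΘB]
    | zero => rw [map_zero]
    | add x y _ _ hx hy => rw [map_add, hx, hy]
    | smul c x _ hx => rw [map_smul, hx]
  have hraise_val : ∀ B ∈ 𝔊, Θ * B = B → B * Θ = -B → ∀ w, B w ∈ V₀ := fun B hB h1 h2 w =>
    Submodule.subset_span ⟨B, hB, h1, h2, w, rfl⟩
  -- lowering operators map into `Q`; `Θ`-commuting operators preserve `Q` and `V₀`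
  have hstab : ∀ A ∈ 𝔊, ∀ u ∈ V₀ ⊔ Q, A u ∈ V₀ ⊔ Q := by
    intro A hA u hu
    obtain ⟨hpm, hΘp, hpΘ⟩ := UnitaryThetaCore.raise_relations hbr hΘ hΘΘ hA
    obtain ⟨hmm, hΘm, hmΘ⟩ := UnitaryThetaCore.lower_relations hbr hΘ hΘΘ hA
    obtain ⟨hdec, hcomm⟩ := UnitaryThetaCore.decomp hΘΘ A
    have hzm := UnitaryThetaCore.zero_mem hbr hΘ hΘΘ hA
    set Ap := (4 : ℂ)⁻¹ • (A + Θ * A - A * Θ - Θ * A * Θ)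
    set Am := (4 : ℂ)⁻¹ • (A - Θ * A + A * Θ - Θ * A * Θ)
    set Az := (2 : ℂ)⁻¹ • (A + Θ * A * Θ)
    -- `Az (B w) = [Az, B] w + B (Az w)` with `[Az, B]` raising: `Az` preserves `V₀`
    have hAzV₀ : ∀ x ∈ V₀, Az x ∈ V₀ := by
      intro x hx
      induction hx using Submodule.span_induction with
      | mem x hx =>
        obtain ⟨B, hB, hΘB, hBΘ, w, rfl⟩ := hx
        have hbrk : Az * B - B * Az ∈ 𝔊 := hbr Az hzm B hB
        have h1' : Θ * (Az * B - B * Az) = Az * B - B * Az := by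
          rw [mul_sub, ← mul_assoc, hcomm, mul_assoc, hΘB, ← mul_assoc, hΘB]
        have h2' : (Az * B - B * Az) * Θ = -(Az * B - B * Az) := by
          rw [sub_mul, mul_assoc, hBΘ, mul_neg, mul_assoc, ← hcomm, ← mul_assoc, hBΘ, neg_mul, neg_sub_neg,
            neg_sub]
        have hx : Az (B w) = (Az * B - B * Az) w + B (Az w) := by
          rw [LinearMap.sub_apply, Module.End.mul_apply, Module.End.mul_apply, sub_add_cancel]
        rw [hx]
        exact Submodule.add_mem _ (hraise_val _ hbrk h1' h2' w) (hraise_val B hB hΘB hBΘ _)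
      | zero => rw [map_zero]; exact Submodule.zero_mem _
      | add x y _ _ hx hy => rw [map_add]; exact Submodule.add_mem _ hx hy
      | smul c x _ hx => rw [map_smul]; exact Submodule.smul_mem _ c hx
    rw [hdec, LinearMap.add_apply, LinearMap.add_apply]
    refine Submodule.add_mem _ (Submodule.add_mem _ (Submodule.mem_sup_left (hraise_val Ap hpm hΘp hpΘ u)) ?_) ?_
    · refine Submodule.mem_sup_right ((hQmem _).2 ?_)
      rw [← Module.End.mul_apply, hΘm, LinearMap.neg_apply]
    · obtain ⟨v, hv, q, hq, rfl⟩ := Submodule.mem_sup.1 hu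
      rw [map_add]
      refine Submodule.add_mem _ (Submodule.mem_sup_left (hAzV₀ v hv)) (Submodule.mem_sup_right ((hQmem _).2 ?_))
      rw [← Module.End.mul_apply, hcomm, Module.End.mul_apply, (hQmem q).1 hq, map_neg]
  -- `V₀ ⊔ Q ≠ ⊥`, hence `= ⊤`
  obtain ⟨q₀, hq₀, hΘq₀⟩ := hQ0
  have htop : V₀ ⊔ Q = ⊤ := by
    rcases hirr _ hstab with h | h
    · exact absurd ((Submodule.eq_bot_iff _).1 h q₀ (Submodule.mem_sup_right ((hQmem q₀).2 hΘq₀))) hq₀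
    · exact h
  -- read off `y ∈ V₀`
  have hyVQ : y ∈ V₀ ⊔ Q := htop ▸ Submodule.mem_top
  obtain ⟨v, hv, q, hq, hvq⟩ := Submodule.mem_sup.1 hyVQ
  have hq0 : q = 0 := by
    have hqP : Θ q = q := by
      have : q = y - v := by rw [← hvq, add_sub_cancel_left]
      rw [this, map_sub, hy, hV₀P v hv]
    have h2 : (2 : ℂ) • q = 0 := by
      rw [two_smul]; nth_rewrite 2 [← hqP]; rw [(hQmem q).1 hq, add_neg_cancel]
    exact (smul_eq_zero.1 h2).resolve_left two_ne_zero
  rw [hq0, add_zero] at hvq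
  exact hvq ▸ hv

/-- **COVERING FACT (1b): no non-zero vector of `Q = {Θ = −1}` is killed by all raising operators of an irreducible
`𝔊`** (that joint kernel is `𝔊`-stable and misses `P ≠ 0`). The symmetric fact is this theorem for `−Θ`.
[cite: Gordon1997, §6 (proof of Thm. 6.3.3, p. 19)] [cite: Ribet1983, Thm. 3] -/
theorem UnitaryThetaCore.eq_zero_of_forall_raise_apply_eq_zero {𝔊 : Submodule ℂ (Module.End ℂ W)}
    (hbr : ∀ Y ∈ 𝔊, ∀ Z ∈ 𝔊, Y * Z - Z * Y ∈ 𝔊)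
    (hirr : ∀ U : Submodule ℂ W, (∀ A ∈ 𝔊, ∀ u ∈ U, A u ∈ U) → U = ⊥ ∨ U = ⊤)
    {Θ : Module.End ℂ W} (hΘ : Θ ∈ 𝔊) (hΘΘ : Θ * Θ = 1) (hP0 : ∃ p : W, p ≠ 0 ∧ Θ p = p)
    {q : W} (hq : Θ q = -q) (hkill : ∀ B ∈ 𝔊, Θ * B = B → B * Θ = -B → B q = 0) : q = 0 := by
  classical
  -- the joint kernel inside `Q`
  set K : Submodule ℂ W :=
    { carrier := {x : W | Θ x = -x ∧ ∀ B ∈ 𝔊, Θ * B = B → B * Θ = -B → B x = 0}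
      zero_mem' := ⟨by rw [map_zero, neg_zero], fun B _ _ _ => map_zero B⟩
      add_mem' := fun {x y} hx hy => ⟨by rw [map_add, hx.1, hy.1, neg_add], fun B hB h1 h2 => by
        rw [map_add, hx.2 B hB h1 h2, hy.2 B hB h1 h2, add_zero]⟩
      smul_mem' := fun c {x} hx => ⟨by rw [map_smul, hx.1, smul_neg], fun B hB h1 h2 => by
        rw [map_smul, hx.2 B hB h1 h2, smul_zero]⟩ } with hKdef
  have hmemK : ∀ x, x ∈ K ↔ Θ x = -x ∧ ∀ B ∈ 𝔊, Θ * B = B → B * Θ = -B → B x = 0 := fun x => Iff.rfl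
  have hlowerQ : ∀ C : Module.End ℂ W, C * Θ = C → ∀ x, Θ x = -x → C x = 0 := fun C hCΘ x hx => by
    have h : C x = -(C x) := by
      conv_lhs => rw [← neg_neg x, ← hx, map_neg, ← Module.End.mul_apply, hCΘ]
    have h2 : (2 : ℂ) • C x = 0 := by rw [two_smul]; nth_rewrite 2 [h]; rw [add_neg_cancel]
    exact (smul_eq_zero.1 h2).resolve_left two_ne_zero
  have hstab : ∀ A ∈ 𝔊, ∀ u ∈ K, A u ∈ K := by
    intro A hA u hu
    obtain ⟨huQ, huk⟩ := (hmemK u).1 hu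
    obtain ⟨hpm, hΘp, hpΘ⟩ := UnitaryThetaCore.raise_relations hbr hΘ hΘΘ hA
    obtain ⟨hmm, hΘm, hmΘ⟩ := UnitaryThetaCore.lower_relations hbr hΘ hΘΘ hA
    obtain ⟨hdec, hcomm⟩ := UnitaryThetaCore.decomp hΘΘ A
    have hzm := UnitaryThetaCore.zero_mem hbr hΘ hΘΘ hA
    set Ap := (4 : ℂ)⁻¹ • (A + Θ * A - A * Θ - Θ * A * Θ)
    set Am := (4 : ℂ)⁻¹ • (A - Θ * A + A * Θ - Θ * A * Θ)
    set Az := (2 : ℂ)⁻¹ • (A + Θ * A * Θ)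
    have hAu : A u = Az u := by
      rw [hdec, LinearMap.add_apply, LinearMap.add_apply, huk Ap hpm hΘp hpΘ, hlowerQ Am hmΘ u huQ, zero_add,
        zero_add]
    rw [hAu]
    refine (hmemK _).2 ⟨by rw [← Module.End.mul_apply, hcomm, Module.End.mul_apply, huQ, map_neg], ?_⟩
    intro B hB hΘB hBΘ
    have hbrk : Az * B - B * Az ∈ 𝔊 := hbr Az hzm B hB
    have h1' : Θ * (Az * B - B * Az) = Az * B - B * Az := by
      rw [mul_sub, ← mul_assoc, hcomm, mul_assoc, hΘB, ← mul_assoc, hΘB]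
    have h2' : (Az * B - B * Az) * Θ = -(Az * B - B * Az) := by
      rw [sub_mul, mul_assoc, hBΘ, mul_neg, mul_assoc, ← hcomm, ← mul_assoc, hBΘ, neg_mul, neg_sub_neg, neg_sub]
    have h := huk _ hbrk h1' h2'
    rw [LinearMap.sub_apply, Module.End.mul_apply, Module.End.mul_apply, huk B hB hΘB hBΘ, map_zero,
      zero_sub, neg_eq_zero] at h
    exact h
  obtain ⟨p₀, hp₀, hΘp₀⟩ := hP0
  rcases hirr K hstab with h | h
  · exact (Submodule.eq_bot_iff _).1 h q ((hmemK q).2 ⟨hq, hkill⟩)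
  · exfalso
    have hpK : p₀ ∈ K := h ▸ Submodule.mem_top
    have hpQ := ((hmemK p₀).1 hpK).1
    rw [hΘp₀] at hpQ
    have h2 : (2 : ℂ) • p₀ = 0 := by rw [two_smul]; nth_rewrite 2 [hpQ]; rw [add_neg_cancel]
    exact hp₀ ((smul_eq_zero.1 h2).resolve_left two_ne_zero)

end Covering

/-! ### §4 `𝔊 = End(W)` from a full-rank pair -/

section Main

variable {W : Type*} [AddCommGroup W] [Module ℂ W]

/-- **`𝔊 = End(W)` FROM A FULL-RANK PAIR** (multiplicities `(a, a+1)`): for `W` irreducible under a bracket-closed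
`𝔊 ∋ 1, Θ` with `dim Q = dim P + 1`, any raising `B ∈ 𝔊` and lowering `C ∈ 𝔊` with `BC|_P` injective force
`𝔊 = End(W)` — §2 and the tree's rank-one criterion `SymplecticThetaSix.eq_top_of_rankOne_idempotent`.
[cite: Ribet1983, Thm. 3] [cite: Gordon1997, Thm. 6.3.3 and pp. 18–19] [cite: MoonenZarhin1999LowDim, §2 (2.4) and Thm. (2.7)]
[cite: Humphreys1972, §19.1] -/
theorem UnitaryThetaCore.eq_top_of_fullRank_pair [FiniteDimensional ℂ W] {𝔊 : Submodule ℂ (Module.End ℂ W)}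
    (hbr : ∀ Y ∈ 𝔊, ∀ Z ∈ 𝔊, Y * Z - Z * Y ∈ 𝔊) (h1 : (1 : Module.End ℂ W) ∈ 𝔊)
    (hirr : ∀ U : Submodule ℂ W, (∀ A ∈ 𝔊, ∀ u ∈ U, A u ∈ U) → U = ⊥ ∨ U = ⊤)
    {Θ : Module.End ℂ W} (hΘ : Θ ∈ 𝔊) (hΘΘ : Θ * Θ = 1)
    {P Q : Submodule ℂ W} (hP : ∀ x, x ∈ P ↔ Θ x = x) (hQ : ∀ x, x ∈ Q ↔ Θ x = -x)
    (hPQ : Module.finrank ℂ Q = Module.finrank ℂ P + 1)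
    {B C : Module.End ℂ W} (hB : B ∈ 𝔊) (hC : C ∈ 𝔊) (hΘB : Θ * B = B) (hBΘ : B * Θ = -B)
    (hΘC : Θ * C = -C) (hCΘ : C * Θ = C) (hinj : ∀ p ∈ P, B (C p) = 0 → p = 0) : 𝔊 = ⊤ := by
  obtain ⟨u, φ, hφu, he⟩ :=
    UnitaryThetaCore.exists_rankOne_idempotent hbr h1 hΘ hΘΘ hP hQ hPQ hB hC hΘB hBΘ hΘC hCΘ hinj
  exact SymplecticThetaSix.eq_top_of_rankOne_idempotent 𝔊 hbr h1 hirr hφu he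

end Main

/-! ### §5 Towards a full-rank pair in dimensions `(2, 3)`: the pencil lemma and an injective lowering operator -/

section Pencil

variable {W : Type*} [AddCommGroup W] [Module ℂ W]

/-- Coordinates on a plane: if `dim P = 2` and `k, p₀ ∈ P` are separated by a linear map (`A k = 0 ≠ A p₀`, `k ≠ 0`),
every `p ∈ P` is `s k + r p₀`. [folklore] -/
private theorem UnitaryThetaCore.exists_pair_coords [FiniteDimensional ℂ W] {P : Submodule ℂ W}
    (hP2 : Module.finrank ℂ P = 2) {k p₀ : W} (hk : k ∈ P) (hp₀ : p₀ ∈ P) (hk0 : k ≠ 0)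
    {A : Module.End ℂ W} (hAk : A k = 0) (hAp₀ : A p₀ ≠ 0) {p : W} (hp : p ∈ P) :
    ∃ s r : ℂ, p = s • k + r • p₀ := by
  have hli : LinearIndependent ℂ ![(⟨k, hk⟩ : P), ⟨p₀, hp₀⟩] := by
    rw [LinearIndependent.pair_iff]
    intro s t hst
    have hW : s • k + t • p₀ = 0 := by
      have := congrArg Subtype.val hst
      simpa using this
    have ht : t = 0 := by
      have h := congrArg A hW
      rw [map_add, map_smul, map_smul, hAk, smul_zero, zero_add, map_zero, smul_eq_zero] at h
      exact h.resolve_right hAp₀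
    rw [ht, zero_smul, add_zero, smul_eq_zero] at hW
    exact ⟨hW.resolve_right hk0, ht⟩
  have hspan := hli.span_eq_top_of_card_eq_finrank (by rw [Fintype.card_fin, hP2])
  have hmem : (⟨p, hp⟩ : P) ∈ Submodule.span ℂ (Set.range ![(⟨k, hk⟩ : P), ⟨p₀, hp₀⟩]) := by
    rw [hspan]; exact Submodule.mem_top
  obtain ⟨c, hc⟩ := (Submodule.mem_span_range_iff_exists_fun ℂ).1 hmem
  refine ⟨c 0, c 1, ?_⟩
  have h := congrArg Subtype.val hc
  simp only [Fin.sum_univ_two, Matrix.cons_val_zero, Matrix.cons_val_one, Submodule.coe_add,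
    Submodule.coe_smul] at h
  exact h.symm

/-- **THE PENCIL LEMMA (closure form).** Let `𝓕` be a family of linear operators closed under addition, all
NON-injective on a plane `P` (`dim P = 2`), without a common kernel vector in `P`, and `A₁ ∈ 𝓕`, `p₀ ∈ P` with
`A₁ p₀ ≠ 0`. Then EVERY `A ∈ 𝓕` maps `P` into the line `ℂ · A₁ p₀`. (For `A k ≠ 0`, `k` a kernel vector of `A₁`:
`A₁ + A` and `A₁ + 2A` singular on `P = ℂk ⊕ ℂp₀` force `A₁p₀, Ap₀ ∈ ℂ·Ak`; the operators killing `k` are reached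
through `A₂ + A` with `A₂ k ≠ 0`.) [folklore] [cite: Gordon1997, §6 (proof of Thm. 6.3.3, p. 19)] -/
theorem UnitaryThetaCore.apply_mem_span_of_pencil [FiniteDimensional ℂ W] {P : Submodule ℂ W}
    (hP2 : Module.finrank ℂ P = 2) (𝓕 : Set (Module.End ℂ W)) (hadd : ∀ A ∈ 𝓕, ∀ A' ∈ 𝓕, A + A' ∈ 𝓕)
    (hsing : ∀ A ∈ 𝓕, ∃ p ∈ P, p ≠ 0 ∧ A p = 0) (hcov : ∀ p ∈ P, p ≠ 0 → ∃ A ∈ 𝓕, A p ≠ 0)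
    {A₁ : Module.End ℂ W} (hA₁ : A₁ ∈ 𝓕) {p₀ : W} (hp₀ : p₀ ∈ P) (hA₁p₀ : A₁ p₀ ≠ 0) :
    ∀ A ∈ 𝓕, ∀ p ∈ P, A p ∈ ℂ ∙ A₁ p₀ := by
  obtain ⟨k, hkP, hk0, hA₁k⟩ := hsing A₁ hA₁
  have hcoord : ∀ p ∈ P, ∃ s r : ℂ, p = s • k + r • p₀ := fun p hp =>
    UnitaryThetaCore.exists_pair_coords hP2 hkP hp₀ hk0 hA₁k hA₁p₀ hp
  -- singularity of `A₁ + A` on `P` when `A k ≠ 0`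
  have hstep : ∀ A ∈ 𝓕, A k ≠ 0 → A₁ p₀ + A p₀ ∈ ℂ ∙ A k := by
    intro A hA hAk
    obtain ⟨p₁, hp₁P, hp₁0, hp₁⟩ := hsing _ (hadd A₁ hA₁ A hA)
    obtain ⟨s, r, rfl⟩ := hcoord p₁ hp₁P
    rw [LinearMap.add_apply, map_add, map_add, map_smul, map_smul, map_smul, map_smul, hA₁k, smul_zero,
      zero_add] at hp₁
    -- `hp₁ : r • A₁ p₀ + (s • A k + r • A p₀) = 0`
    by_cases hr : r = 0
    · exfalso
      rw [hr, zero_smul, zero_smul, zero_add, add_zero, smul_eq_zero] at hp₁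
      rcases hp₁ with hs | hAk'
      · exact hp₁0 (by rw [hs, hr, zero_smul, zero_smul, add_zero])
      · exact hAk hAk'
    · have h : A₁ p₀ + A p₀ = (-(s / r)) • A k := by
        have h' : r • (A₁ p₀ + A p₀) = -(s • A k) := by
          rw [smul_add]; exact eq_neg_of_add_eq_zero_left (by rw [← hp₁]; abel)
        have := congrArg (fun x => r⁻¹ • x) h'
        simp only [smul_smul, inv_mul_cancel₀ hr, one_smul, smul_neg] at this
        rw [this, neg_smul, div_eq_inv_mul]
      exact h ▸ Submodule.smul_mem _ _ (Submodule.mem_span_singleton_self _)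
  have hkey : ∀ A ∈ 𝓕, A k ≠ 0 → ∀ p ∈ P, A₁ p ∈ ℂ ∙ A k ∧ A p ∈ ℂ ∙ A k := by
    intro A hA hAk p hp
    have h1 := hstep A hA hAk
    have h2 : A₁ p₀ + (A + A) p₀ ∈ ℂ ∙ (A + A) k := hstep (A + A) (hadd A hA A hA) (by
      rw [LinearMap.add_apply, ← two_smul ℂ, smul_ne_zero_iff]; exact ⟨two_ne_zero, hAk⟩)
    have hspan2 : (ℂ ∙ (A + A) k) ≤ ℂ ∙ A k := by
      rw [Submodule.span_singleton_le_iff_mem, LinearMap.add_apply]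
      exact Submodule.add_mem _ (Submodule.mem_span_singleton_self _) (Submodule.mem_span_singleton_self _)
    have h2' : A₁ p₀ + (A p₀ + A p₀) ∈ ℂ ∙ A k := hspan2 (by rwa [LinearMap.add_apply] at h2)
    have hAp₀ : A p₀ ∈ ℂ ∙ A k := by
      have := Submodule.sub_mem _ h2' h1
      rwa [show A₁ p₀ + (A p₀ + A p₀) - (A₁ p₀ + A p₀) = A p₀ by abel] at this
    have hA₁p₀' : A₁ p₀ ∈ ℂ ∙ A k := by
      have := Submodule.sub_mem _ h1 hAp₀
      rwa [add_sub_cancel_right] at this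
    obtain ⟨s, r, rfl⟩ := hcoord p hp
    refine ⟨?_, ?_⟩
    · rw [map_add, map_smul, map_smul, hA₁k, smul_zero, zero_add]
      exact Submodule.smul_mem _ _ hA₁p₀'
    · rw [map_add, map_smul, map_smul]
      exact Submodule.add_mem _ (Submodule.smul_mem _ _ (Submodule.mem_span_singleton_self _))
        (Submodule.smul_mem _ _ hAp₀)
  -- the line `ℂ · A k` is `ℂ · A₁ p₀` whenever `A k ≠ 0`
  have hline : ∀ A ∈ 𝓕, A k ≠ 0 → (ℂ ∙ A k) ≤ ℂ ∙ A₁ p₀ := by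
    intro A hA hAk
    obtain ⟨c, hc⟩ := Submodule.mem_span_singleton.1 ((hkey A hA hAk p₀ hp₀).1)
    have hc0 : c ≠ 0 := by rintro rfl; exact hA₁p₀ (by rw [← hc, zero_smul])
    rw [Submodule.span_singleton_le_iff_mem]
    have : A k = c⁻¹ • A₁ p₀ := by rw [← hc, smul_smul, inv_mul_cancel₀ hc0, one_smul]
    exact this ▸ Submodule.smul_mem _ _ (Submodule.mem_span_singleton_self _)
  obtain ⟨A₂, hA₂, hA₂k⟩ := hcov k hkP hk0
  intro A hA p hp
  by_cases hAk : A k = 0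
  · have hA₂A : (A₂ + A) k ≠ 0 := by rwa [LinearMap.add_apply, hAk, add_zero]
    have h1 := hline _ (hadd A₂ hA₂ A hA) hA₂A ((hkey _ (hadd A₂ hA₂ A hA) hA₂A p hp).2)
    have h2 := hline A₂ hA₂ hA₂k ((hkey A₂ hA₂ hA₂k p hp).2)
    have := Submodule.sub_mem _ h1 h2
    rwa [LinearMap.add_apply, add_sub_cancel_left] at this
  · exact hline A hA hAk ((hkey A hA hAk p hp).2)

/-- **An irreducible `𝔊` has a lowering operator injective on `P`** (`dim P = 2`, `dim Q ≥ 2`): otherwise, by the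
pencil lemma and the covering facts for lowering operators, all their values lie on one line, while they span `Q`.
[cite: Gordon1997, §6 (proof of Thm. 6.3.3, p. 19)] [cite: Ribet1983, Thm. 3] -/
theorem UnitaryThetaCore.exists_lower_injOn [FiniteDimensional ℂ W] {𝔊 : Submodule ℂ (Module.End ℂ W)}
    (hbr : ∀ Y ∈ 𝔊, ∀ Z ∈ 𝔊, Y * Z - Z * Y ∈ 𝔊)
    (hirr : ∀ U : Submodule ℂ W, (∀ A ∈ 𝔊, ∀ u ∈ U, A u ∈ U) → U = ⊥ ∨ U = ⊤)
    {Θ : Module.End ℂ W} (hΘ : Θ ∈ 𝔊) (hΘΘ : Θ * Θ = 1)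
    {P Q : Submodule ℂ W} (hP : ∀ x, x ∈ P ↔ Θ x = x) (hQ : ∀ x, x ∈ Q ↔ Θ x = -x)
    (hP2 : Module.finrank ℂ P = 2) (hQ2 : 2 ≤ Module.finrank ℂ Q) :
    ∃ C ∈ 𝔊, Θ * C = -C ∧ C * Θ = C ∧ ∀ p ∈ P, C p = 0 → p = 0 := by
  classical
  have hΘΘv : ∀ v, Θ (Θ v) = v := fun v => by rw [← Module.End.mul_apply, hΘΘ, Module.End.one_apply]
  have hnΘ : -Θ ∈ 𝔊 := Submodule.neg_mem _ hΘ
  have hnΘΘ : (-Θ) * (-Θ) = 1 := by rw [neg_mul_neg, hΘΘ]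
  -- non-zero vectors of `P` and `Q`
  obtain ⟨p₀, hp₀P, hp₀0⟩ : ∃ p₀ ∈ P, p₀ ≠ 0 := by
    by_contra hne
    push Not at hne
    have : P = ⊥ := by rw [eq_bot_iff]; intro x hx; rw [Submodule.mem_bot]; exact hne x hx
    rw [this, finrank_bot] at hP2; exact two_ne_zero hP2.symm
  obtain ⟨q₀, hq₀Q, hq₀0⟩ : ∃ q₀ ∈ Q, q₀ ≠ 0 := by
    by_contra hne
    push Not at hne
    have : Q = ⊥ := by rw [eq_bot_iff]; intro x hx; rw [Submodule.mem_bot]; exact hne x hx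
    rw [this, finrank_bot] at hQ2; exact absurd hQ2 (by norm_num)
  by_contra hall
  push Not at hall
  -- the family of lowering operators
  set 𝓕 : Set (Module.End ℂ W) := {C | C ∈ 𝔊 ∧ Θ * C = -C ∧ C * Θ = C} with h𝓕
  have hadd : ∀ A ∈ 𝓕, ∀ A' ∈ 𝓕, A + A' ∈ 𝓕 := fun A hA A' hA' =>
    ⟨Submodule.add_mem _ hA.1 hA'.1, by rw [mul_add, hA.2.1, hA'.2.1, neg_add], by rw [add_mul, hA.2.2, hA'.2.2]⟩
  have hsing : ∀ A ∈ 𝓕, ∃ p ∈ P, p ≠ 0 ∧ A p = 0 := fun A hA => by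
    obtain ⟨p, hp, hAp, hp0⟩ := hall A hA.1 hA.2.1 hA.2.2
    exact ⟨p, hp, hp0, hAp⟩
  -- covering fact (1d): no vector of `P` is killed by all lowering operators
  have hcov : ∀ p ∈ P, p ≠ 0 → ∃ A ∈ 𝓕, A p ≠ 0 := by
    intro p hp hp0
    by_contra hne
    push Not at hne
    refine hp0 (UnitaryThetaCore.eq_zero_of_forall_raise_apply_eq_zero hbr hirr hnΘ hnΘΘ
      ⟨q₀, hq₀0, by rw [LinearMap.neg_apply, (hQ q₀).1 hq₀Q, neg_neg]⟩
      (by rw [LinearMap.neg_apply, (hP p).1 hp]) fun B hB h1 h2 => hne B ⟨hB, ?_, ?_⟩)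
    · rw [neg_mul, neg_eq_iff_eq_neg] at h1; exact h1
    · rw [mul_neg, neg_inj] at h2; exact h2
  obtain ⟨C₁, hC₁, hC₁p₀⟩ := hcov p₀ hp₀P hp₀0
  have hℓ := UnitaryThetaCore.apply_mem_span_of_pencil hP2 𝓕 hadd hsing hcov hC₁ hp₀P hC₁p₀
  -- all values of lowering operators lie on the line `ℓ = ℂ · C₁ p₀`
  have hvals : ∀ C ∈ 𝓕, ∀ w, C w ∈ ℂ ∙ C₁ p₀ := by
    intro C hC w
    have hsplit : (2 : ℂ)⁻¹ • (w + Θ w) + (2 : ℂ)⁻¹ • (w - Θ w) = w := by module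
    have hPw : (2 : ℂ)⁻¹ • (w + Θ w) ∈ P := (hP _).2 (by rw [map_smul, map_add, hΘΘv, add_comm])
    have hQw : C ((2 : ℂ)⁻¹ • (w - Θ w)) = 0 := by
      have hx : Θ ((2 : ℂ)⁻¹ • (w - Θ w)) = -((2 : ℂ)⁻¹ • (w - Θ w)) := by
        rw [map_smul, map_sub, hΘΘv, ← smul_neg, neg_sub]
      have h : C ((2 : ℂ)⁻¹ • (w - Θ w)) = -(C ((2 : ℂ)⁻¹ • (w - Θ w))) := by
        conv_lhs => rw [← neg_neg ((2 : ℂ)⁻¹ • (w - Θ w)), ← hx, map_neg, ← Module.End.mul_apply, hC.2.2]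
      have h2 : (2 : ℂ) • C ((2 : ℂ)⁻¹ • (w - Θ w)) = 0 := by rw [two_smul]; nth_rewrite 2 [h]; rw [add_neg_cancel]
      exact (smul_eq_zero.1 h2).resolve_left two_ne_zero
    rw [← hsplit, map_add, hQw, add_zero]
    exact hℓ C hC _ hPw
  -- covering fact (1c): the values of lowering operators span `Q`
  have hQle : Q ≤ ℂ ∙ C₁ p₀ := by
    intro y hy
    have hy' : (-Θ) y = y := by rw [LinearMap.neg_apply, (hQ y).1 hy, neg_neg]
    have h := UnitaryThetaCore.mem_span_raise_apply hbr hirr hnΘ hnΘΘ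
      ⟨p₀, hp₀0, by rw [LinearMap.neg_apply, (hP p₀).1 hp₀P]⟩ hy'
    refine (Submodule.span_le.2 ?_) h
    rintro _ ⟨B, hB, h1, h2, w, rfl⟩
    refine hvals B ⟨hB, ?_, ?_⟩ w
    · rw [neg_mul, neg_eq_iff_eq_neg] at h1; exact h1
    · rw [mul_neg, neg_inj] at h2; exact h2
  have h1 : Module.finrank ℂ Q ≤ 1 :=
    (Submodule.finrank_mono hQle).trans (finrank_span_singleton hC₁p₀).le
  omega

/-- Coordinates on a plane, basic form: `dim P = 2`, `0 ≠ a ∈ P`, `b ∈ P ∖ ℂa` ⟹ every `x ∈ P` is `s a + r b`.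
[folklore] -/
private theorem UnitaryThetaCore.exists_pair_coords_of_not_mem [FiniteDimensional ℂ W] {P : Submodule ℂ W}
    (hP2 : Module.finrank ℂ P = 2) {a b : W} (ha : a ∈ P) (hb : b ∈ P) (ha0 : a ≠ 0) (hba : b ∉ ℂ ∙ a)
    {x : W} (hx : x ∈ P) : ∃ s r : ℂ, x = s • a + r • b := by
  have hli : LinearIndependent ℂ ![(⟨a, ha⟩ : P), ⟨b, hb⟩] := by
    rw [LinearIndependent.pair_iff' (fun h => ha0 (congrArg Subtype.val h))]
    intro c hc
    exact hba (Submodule.mem_span_singleton.2 ⟨c, by simpa using congrArg Subtype.val hc⟩)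
  have hspan := hli.span_eq_top_of_card_eq_finrank (by rw [Fintype.card_fin, hP2])
  have hmem : (⟨x, hx⟩ : P) ∈ Submodule.span ℂ (Set.range ![(⟨a, ha⟩ : P), ⟨b, hb⟩]) := by
    rw [hspan]; exact Submodule.mem_top
  obtain ⟨c, hc⟩ := (Submodule.mem_span_range_iff_exists_fun ℂ).1 hmem
  refine ⟨c 0, c 1, ?_⟩
  have h := congrArg Subtype.val hc
  simp only [Fin.sum_univ_two, Matrix.cons_val_zero, Matrix.cons_val_one, Submodule.coe_add,
    Submodule.coe_smul] at h
  exact h.symm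

/-- A hyperplane complement: `U ≤ Q`, `dim Q = dim U + 1`, `q' ∈ Q ∖ U` ⟹ `Q = U ⊕ ℂq'` (every `q ∈ Q` is `u + s q'`).
[folklore] -/
private theorem UnitaryThetaCore.exists_add_smul_of_finrank [FiniteDimensional ℂ W] {U Q : Submodule ℂ W} (hUQ : U ≤ Q)
    (hdim : Module.finrank ℂ Q = Module.finrank ℂ U + 1) {q' : W} (hq'Q : q' ∈ Q) (hq'U : q' ∉ U)
    {q : W} (hq : q ∈ Q) : ∃ u ∈ U, ∃ s : ℂ, q = u + s • q' := by
  have hq'0 : q' ≠ 0 := fun h => hq'U (h ▸ Submodule.zero_mem U)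
  have hinf : U ⊓ (ℂ ∙ q') = ⊥ := by
    rw [eq_bot_iff]
    rintro x ⟨hxU, hxq⟩
    obtain ⟨c, rfl⟩ := Submodule.mem_span_singleton.1 hxq
    by_cases hc : c = 0
    · rw [hc, zero_smul]; exact Submodule.zero_mem _
    · exact absurd ((Submodule.smul_mem_iff _ hc).1 hxU) hq'U
  have hsup : U ⊔ (ℂ ∙ q') = Q := by
    apply Submodule.eq_of_le_of_finrank_eq (sup_le hUQ ((Submodule.span_singleton_le_iff_mem q' Q).2 hq'Q))
    have h := Submodule.finrank_sup_add_finrank_inf_eq U (ℂ ∙ q')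
    rw [hinf, finrank_bot, add_zero, finrank_span_singleton hq'0] at h
    omega
  obtain ⟨u, hu, v, hv, rfl⟩ := Submodule.mem_sup.1 (hsup.symm ▸ hq : q ∈ U ⊔ (ℂ ∙ q'))
  obtain ⟨s, rfl⟩ := Submodule.mem_span_singleton.1 hv
  exact ⟨u, hu, s, rfl⟩

/-- **A FULL-RANK PAIR EXISTS in dimensions `(2,3)`**: for `W` irreducible under a bracket-closed `𝔊 ∋ Θ` with
`dim P = 2`, `dim Q = 3`, some raising `B ∈ 𝔊` and lowering `C ∈ 𝔊` have `BC|_P` injective. (Pencil lemma for the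
families `{B·C_t}`, `C_t = C + tC'` injective for all but one `t ≠ 0`; the raising operators with values on the line
`ℓ` then kill `C(P)`, and a kernel vector of `B₀C|_P` is killed by every raising operator, contradicting the covering
fact (1b).) [cite: Ribet1983, Thm. 3] [cite: Gordon1997, §6 (proof of Thm. 6.3.3, p. 19)] [cite: MoonenZarhin1999LowDim, §2 (2.4)] -/
theorem UnitaryThetaCore.exists_fullRank_pair [FiniteDimensional ℂ W] {𝔊 : Submodule ℂ (Module.End ℂ W)}
    (hbr : ∀ Y ∈ 𝔊, ∀ Z ∈ 𝔊, Y * Z - Z * Y ∈ 𝔊)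
    (hirr : ∀ U : Submodule ℂ W, (∀ A ∈ 𝔊, ∀ u ∈ U, A u ∈ U) → U = ⊥ ∨ U = ⊤)
    {Θ : Module.End ℂ W} (hΘ : Θ ∈ 𝔊) (hΘΘ : Θ * Θ = 1)
    {P Q : Submodule ℂ W} (hP : ∀ x, x ∈ P ↔ Θ x = x) (hQ : ∀ x, x ∈ Q ↔ Θ x = -x)
    (hP2 : Module.finrank ℂ P = 2) (hQ3 : Module.finrank ℂ Q = 3) :
    ∃ B ∈ 𝔊, ∃ C ∈ 𝔊, Θ * B = B ∧ B * Θ = -B ∧ Θ * C = -C ∧ C * Θ = C ∧ ∀ p ∈ P, B (C p) = 0 → p = 0 := by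
  classical
  have hΘΘv : ∀ v, Θ (Θ v) = v := fun v => by rw [← Module.End.mul_apply, hΘΘ, Module.End.one_apply]
  have hnΘ : -Θ ∈ 𝔊 := Submodule.neg_mem _ hΘ
  have hnΘΘ : (-Θ) * (-Θ) = 1 := by rw [neg_mul_neg, hΘΘ]
  -- kill / into lemmas
  have hraiseP : ∀ B : Module.End ℂ W, B * Θ = -B → ∀ p ∈ P, B p = 0 := fun B hBΘ p hp => by
    have h : B p = -(B p) := by
      conv_lhs => rw [← (hP p).1 hp]
      rw [← Module.End.mul_apply, hBΘ, LinearMap.neg_apply]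
    have h2 : (2 : ℂ) • B p = 0 := by rw [two_smul]; nth_rewrite 2 [h]; rw [add_neg_cancel]
    exact (smul_eq_zero.1 h2).resolve_left two_ne_zero
  have hlowerQ : ∀ C : Module.End ℂ W, C * Θ = C → ∀ q ∈ Q, C q = 0 := fun C hCΘ q hq => by
    have h : C q = -(C q) := by
      conv_lhs => rw [← neg_neg q, ← (hQ q).1 hq, map_neg, ← Module.End.mul_apply, hCΘ]
    have h2 : (2 : ℂ) • C q = 0 := by rw [two_smul]; nth_rewrite 2 [h]; rw [add_neg_cancel]
    exact (smul_eq_zero.1 h2).resolve_left two_ne_zero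
  have hraise_into : ∀ B : Module.End ℂ W, Θ * B = B → ∀ w, B w ∈ P := fun B hΘB w =>
    (hP _).2 (by rw [← Module.End.mul_apply, hΘB])
  have hlower_into : ∀ C : Module.End ℂ W, Θ * C = -C → ∀ w, C w ∈ Q := fun C hΘC w =>
    (hQ _).2 (by rw [← Module.End.mul_apply, hΘC, LinearMap.neg_apply])
  have hPhat : ∀ w, (2 : ℂ)⁻¹ • (w + Θ w) ∈ P := fun w => (hP _).2 (by rw [map_smul, map_add, hΘΘv, add_comm])
  have hQhat : ∀ w, (2 : ℂ)⁻¹ • (w - Θ w) ∈ Q := fun w =>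
    (hQ _).2 (by rw [map_smul, map_sub, hΘΘv, ← smul_neg, neg_sub])
  have hsplit : ∀ w, (2 : ℂ)⁻¹ • (w + Θ w) + (2 : ℂ)⁻¹ • (w - Θ w) = w := fun w => by module
  -- non-zero vectors
  obtain ⟨p₀, hp₀P, hp₀0⟩ : ∃ p₀ ∈ P, p₀ ≠ 0 := by
    by_contra hne
    push Not at hne
    have : P = ⊥ := by rw [eq_bot_iff]; intro x hx; rw [Submodule.mem_bot]; exact hne x hx
    rw [this, finrank_bot] at hP2; exact two_ne_zero hP2.symm
  -- covering facts packaged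
  have h1b : ∀ q ∈ Q, q ≠ 0 → ∃ B ∈ 𝔊, Θ * B = B ∧ B * Θ = -B ∧ B q ≠ 0 := by
    intro q hq hq0
    by_contra hne
    push Not at hne
    exact hq0 (UnitaryThetaCore.eq_zero_of_forall_raise_apply_eq_zero hbr hirr hΘ hΘΘ
      ⟨p₀, hp₀0, (hP p₀).1 hp₀P⟩ ((hQ q).1 hq) fun B hB h1 h2 => hne B hB h1 h2)
  have h1a : ∀ y ∈ P, y ∈ Submodule.span ℂ {x : W | ∃ B ∈ 𝔊, Θ * B = B ∧ B * Θ = -B ∧ ∃ w, B w = x} := by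
    intro y hy
    obtain ⟨q₀, hq₀Q, hq₀0⟩ : ∃ q₀ ∈ Q, q₀ ≠ 0 := by
      by_contra hne
      push Not at hne
      have : Q = ⊥ := by rw [eq_bot_iff]; intro x hx; rw [Submodule.mem_bot]; exact hne x hx
      rw [this, finrank_bot] at hQ3; exact absurd hQ3 (by norm_num)
    exact UnitaryThetaCore.mem_span_raise_apply hbr hirr hΘ hΘΘ ⟨q₀, hq₀0, (hQ q₀).1 hq₀Q⟩ ((hP y).1 hy)
  have h1c : ∀ y ∈ Q, y ∈ Submodule.span ℂ {x : W | ∃ C ∈ 𝔊, Θ * C = -C ∧ C * Θ = C ∧ ∃ w, C w = x} := by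
    intro y hy
    have h := UnitaryThetaCore.mem_span_raise_apply hbr hirr hnΘ hnΘΘ
      ⟨p₀, hp₀0, by rw [LinearMap.neg_apply, (hP p₀).1 hp₀P]⟩
      (y := y) (by rw [LinearMap.neg_apply, (hQ y).1 hy, neg_neg])
    refine Submodule.span_mono ?_ h
    rintro x ⟨B, hB, h1, h2, w, rfl⟩
    exact ⟨B, hB, by rwa [neg_mul, neg_eq_iff_eq_neg] at h1, by rwa [mul_neg, neg_inj] at h2, w, rfl⟩
  by_contra hno
  push Not at hno
  -- `hno : ∀ B ∈ 𝔊, ∀ C ∈ 𝔊, ΘB = B → BΘ = -B → ΘC = -C → CΘ = C → ∃ p ∈ P, B (C p) = 0 ∧ p ≠ 0`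
  -- (B1): for a lowering `C'` injective on `P`, all `B(C'P)` lie on one line `ℂa`, `0 ≠ a ∈ P`
  have hB1 : ∀ C' ∈ 𝔊, Θ * C' = -C' → C' * Θ = C' → (∀ p ∈ P, C' p = 0 → p = 0) →
      ∃ a ∈ P, a ≠ 0 ∧ ∀ B ∈ 𝔊, Θ * B = B → B * Θ = -B → ∀ p ∈ P, B (C' p) ∈ ℂ ∙ a := by
    intro C' hC' hΘC' hC'Θ hinj'
    set 𝓕 : Set (Module.End ℂ W) := {A | ∃ B ∈ 𝔊, Θ * B = B ∧ B * Θ = -B ∧ A = B * C'} with h𝓕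
    have hadd : ∀ A ∈ 𝓕, ∀ A' ∈ 𝓕, A + A' ∈ 𝓕 := by
      rintro _ ⟨B, hB, h1, h2, rfl⟩ _ ⟨B', hB', h1', h2', rfl⟩
      exact ⟨B + B', Submodule.add_mem _ hB hB', by rw [mul_add, h1, h1'], by rw [add_mul, h2, h2', neg_add],
        by rw [add_mul]⟩
    have hsing : ∀ A ∈ 𝓕, ∃ p ∈ P, p ≠ 0 ∧ A p = 0 := by
      rintro _ ⟨B, hB, h1, h2, rfl⟩
      obtain ⟨p, hp, hBCp, hp0⟩ := hno B hB C' hC' h1 h2 hΘC' hC'Θ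
      exact ⟨p, hp, hp0, by rw [Module.End.mul_apply, hBCp]⟩
    have hcov : ∀ p ∈ P, p ≠ 0 → ∃ A ∈ 𝓕, A p ≠ 0 := by
      intro p hp hp0
      have hC'p : C' p ≠ 0 := fun h => hp0 (hinj' p hp h)
      obtain ⟨B, hB, h1, h2, hBq⟩ := h1b (C' p) (hlower_into C' hΘC' p) hC'p
      exact ⟨B * C', ⟨B, hB, h1, h2, rfl⟩, by rwa [Module.End.mul_apply]⟩
    obtain ⟨A₁, hA₁, hA₁p₀⟩ := hcov p₀ hp₀P hp₀0
    have hℓ := UnitaryThetaCore.apply_mem_span_of_pencil hP2 𝓕 hadd hsing hcov hA₁ hp₀P hA₁p₀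
    obtain ⟨B₁, hB₁, hΘB₁, -, rfl⟩ := hA₁
    refine ⟨(B₁ * C') p₀, hraise_into _ (by rw [← mul_assoc, hΘB₁]) p₀, hA₁p₀, fun B hB h1 h2 p hp => ?_⟩
    have := hℓ (B * C') ⟨B, hB, h1, h2, rfl⟩ p hp
    rwa [Module.End.mul_apply] at this
  -- an injective lowering `C`, its line `ℓ = ℂa`
  obtain ⟨C, hC, hΘC, hCΘ, hCinj⟩ :=
    UnitaryThetaCore.exists_lower_injOn hbr hirr hΘ hΘΘ hP hQ hP2 (by omega)
  obtain ⟨a, haP, ha0, hℓ⟩ := hB1 C hC hΘC hCΘ hCinj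
  -- `B₀` raising and `q' ∈ Q` with `B₀ q' ∉ ℓ`
  obtain ⟨B₀, hB₀, hΘB₀, hB₀Θ, q', hq'Q, hB₀q'⟩ :
      ∃ B₀ ∈ 𝔊, Θ * B₀ = B₀ ∧ B₀ * Θ = -B₀ ∧ ∃ q' ∈ Q, B₀ q' ∉ ℂ ∙ a := by
    by_contra hne
    push Not at hne
    have hPle : P ≤ ℂ ∙ a := by
      intro y hy
      refine (Submodule.span_le.2 ?_) (h1a y hy)
      rintro _ ⟨B, hB, h1, h2, w, rfl⟩
      rw [← hsplit w, map_add, hraiseP B h2 _ (hPhat w), zero_add]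
      exact hne B hB h1 h2 _ (hQhat w)
    have := (Submodule.finrank_mono hPle).trans (finrank_span_singleton ha0).le
    omega
  -- `Π = C(P)` has dimension `2`; `q' ∉ Π`
  have hfinPi : Module.finrank ℂ (P.map C) = 2 := by
    have hginj : Function.Injective (C ∘ₗ P.subtype) := by
      intro x y hxy
      apply Subtype.ext
      have h : C (x - y : P) = 0 := by rw [Submodule.coe_sub, map_sub]; exact sub_eq_zero.2 hxy
      exact sub_eq_zero.1 (by exact_mod_cast hCinj _ (x - y).2 h)
    rw [← hP2, ← LinearMap.finrank_range_of_inj hginj, LinearMap.range_comp, Submodule.range_subtype]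
  have hPiQ : P.map C ≤ Q := by rintro _ ⟨p, -, rfl⟩; exact hlower_into C hΘC p
  have hq'Pi : q' ∉ P.map C := by
    rintro ⟨p, hp, rfl⟩
    exact hB₀q' (hℓ B₀ hB₀ hΘB₀ hB₀Θ p hp)
  have hQdec : ∀ q ∈ Q, ∃ u ∈ P.map C, ∃ s : ℂ, q = u + s • q' := fun q hq =>
    UnitaryThetaCore.exists_add_smul_of_finrank hPiQ (by rw [hfinPi, hQ3]) hq'Q hq'Pi hq
  -- a lowering `C'` and `p' ∈ P` with `C' p' ∉ Π`
  obtain ⟨C', hC', hΘC', hC'Θ, p', hp'P, hC'p'⟩ :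
      ∃ C' ∈ 𝔊, Θ * C' = -C' ∧ C' * Θ = C' ∧ ∃ p' ∈ P, C' p' ∉ P.map C := by
    by_contra hne
    push Not at hne
    have hQle : Q ≤ P.map C := by
      intro y hy
      refine (Submodule.span_le.2 ?_) (h1c y hy)
      rintro _ ⟨C'', hC'', h1, h2, w, rfl⟩
      rw [← hsplit w, map_add, hlowerQ C'' h2 _ (hQhat w), add_zero]
      exact hne C'' hC'' h1 h2 _ (hPhat w)
    have := Submodule.finrank_mono hQle
    omega
  -- `B₀ (C' p') ∉ ℓ`
  have hB₀C'p' : B₀ (C' p') ∉ ℂ ∙ a := by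
    obtain ⟨u, ⟨p'', hp'', rfl⟩, s, hs⟩ := hQdec (C' p') (hlower_into C' hΘC' p')
    have hs0 : s ≠ 0 := by
      rintro rfl
      rw [zero_smul, add_zero] at hs
      exact hC'p' (hs ▸ ⟨p'', hp'', rfl⟩)
    intro hmem
    rw [hs, map_add, map_smul] at hmem
    have h := Submodule.sub_mem _ hmem (hℓ B₀ hB₀ hΘB₀ hB₀Θ p'' hp'')
    rw [add_sub_cancel_left] at h
    exact hB₀q' ((Submodule.smul_mem_iff _ hs0).1 h)
  -- the pencil `C_t = C + t C'`
  have hCt : ∀ t : ℂ, C + t • C' ∈ 𝔊 ∧ Θ * (C + t • C') = -(C + t • C') ∧ (C + t • C') * Θ = C + t • C' :=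
    fun t => ⟨Submodule.add_mem _ hC (Submodule.smul_mem _ t hC'),
      by rw [mul_add, mul_smul_comm, hΘC, hΘC', smul_neg, neg_add],
      by rw [add_mul, smul_mul_assoc, hCΘ, hC'Θ]⟩
  -- at most one non-zero `t` is bad
  have hbad : ∀ t₁ t₂ : ℂ, t₁ ≠ 0 → t₂ ≠ 0 → t₁ ≠ t₂ →
      (∃ p ∈ P, p ≠ 0 ∧ (C + t₁ • C') p = 0) → (∃ p ∈ P, p ≠ 0 ∧ (C + t₂ • C') p = 0) → False := by
    rintro t₁ t₂ ht₁ ht₂ hne ⟨p₁, hp₁P, hp₁0, hp₁⟩ ⟨p₂, hp₂P, hp₂0, hp₂⟩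
    rw [LinearMap.add_apply, LinearMap.smul_apply, add_eq_zero_iff_eq_neg] at hp₁ hp₂
    -- `C' pᵢ ∈ Π`
    have hmemPi : ∀ (t : ℂ) (p : W), t ≠ 0 → p ∈ P → C p = -(t • C' p) → C' p ∈ P.map C := fun t p ht hp h =>
      ⟨-(t⁻¹) • p, Submodule.smul_mem _ _ hp, by rw [map_smul, h, neg_smul, smul_neg, neg_neg, smul_smul,
        inv_mul_cancel₀ ht, one_smul]⟩
    have h1 := hmemPi t₁ p₁ ht₁ hp₁P hp₁
    have h2 := hmemPi t₂ p₂ ht₂ hp₂P hp₂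
    by_cases hdep : p₂ ∈ ℂ ∙ p₁
    · obtain ⟨c, rfl⟩ := Submodule.mem_span_singleton.1 hdep
      have hc : c ≠ 0 := by rintro rfl; exact hp₂0 (zero_smul _ _)
      rw [map_smul, map_smul, smul_comm t₂ c, ← smul_neg] at hp₂
      have hp₂' := smul_right_injective W hc hp₂
      -- `C p₁ = -(t₁ C' p₁) = -(t₂ C' p₁)`
      have h : (t₁ - t₂) • C' p₁ = 0 := by
        rw [sub_smul, sub_eq_zero]
        have := hp₁.symm.trans hp₂'
        exact neg_inj.1 this
      rw [smul_eq_zero] at h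
      rcases h with h | h
      · exact hne (sub_eq_zero.1 h)
      · rw [h, smul_zero, neg_zero] at hp₁
        exact hp₁0 (hCinj p₁ hp₁P hp₁)
    · obtain ⟨s, r, hsr⟩ := UnitaryThetaCore.exists_pair_coords_of_not_mem hP2 hp₁P hp₂P hp₁0 hdep hp'P
      apply hC'p'
      rw [hsr, map_add, map_smul, map_smul]
      exact Submodule.add_mem _ (Submodule.smul_mem _ _ h1) (Submodule.smul_mem _ _ h2)
  -- good `t`: `C_t` injective on `P`; two distinct good values among `1, 2, 3`
  have hgood_or : ∀ t₁ t₂ : ℂ, t₁ ≠ 0 → t₂ ≠ 0 → t₁ ≠ t₂ →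
      (∀ p ∈ P, (C + t₁ • C') p = 0 → p = 0) ∨ (∀ p ∈ P, (C + t₂ • C') p = 0 → p = 0) := by
    intro t₁ t₂ ht₁ ht₂ hne
    by_contra h
    rw [not_or] at h
    obtain ⟨h1, h2⟩ := h
    push Not at h1 h2
    obtain ⟨p₁, hp₁, hq₁, hp₁0⟩ := h1
    obtain ⟨p₂, hp₂, hq₂, hp₂0⟩ := h2
    exact hbad t₁ t₂ ht₁ ht₂ hne ⟨p₁, hp₁, hp₁0, hq₁⟩ ⟨p₂, hp₂, hp₂0, hq₂⟩
  obtain ⟨t, t', ht0, ht'0, htt', hgt, hgt'⟩ : ∃ t t' : ℂ, t ≠ 0 ∧ t' ≠ 0 ∧ t ≠ t' ∧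
      (∀ p ∈ P, (C + t • C') p = 0 → p = 0) ∧ (∀ p ∈ P, (C + t' • C') p = 0 → p = 0) := by
    rcases hgood_or 1 2 one_ne_zero two_ne_zero (by norm_num) with g1 | g2
    · rcases hgood_or 2 3 two_ne_zero three_ne_zero (by norm_num) with g2 | g3
      · exact ⟨1, 2, one_ne_zero, two_ne_zero, by norm_num, g1, g2⟩
      · exact ⟨1, 3, one_ne_zero, three_ne_zero, by norm_num, g1, g3⟩
    · rcases hgood_or 1 3 one_ne_zero three_ne_zero (by norm_num) with g1 | g3
      · exact ⟨2, 1, two_ne_zero, one_ne_zero, by norm_num, g2, g1⟩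
      · exact ⟨2, 3, two_ne_zero, three_ne_zero, by norm_num, g2, g3⟩
  -- for a good `t ≠ 0`: raising operators with values in `ℓ` kill `C_t(P)`
  have hkill : ∀ t : ℂ, t ≠ 0 → (∀ p ∈ P, (C + t • C') p = 0 → p = 0) →
      ∀ B₁ ∈ 𝔊, Θ * B₁ = B₁ → B₁ * Θ = -B₁ → (∀ w, B₁ w ∈ ℂ ∙ a) → ∀ p ∈ P, B₁ ((C + t • C') p) = 0 := by
    intro t ht hgood B₁ hB₁ hΘB₁ hB₁Θ hvals p hp
    obtain ⟨aₜ, -, -, hℓt⟩ := hB1 (C + t • C') (hCt t).1 (hCt t).2.1 (hCt t).2.2 hgood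
    -- `B₀ (C_t p') ∉ ℓ`, so the lines `ℂaₜ` and `ℓ` meet in `0`
    have hB₀t : B₀ ((C + t • C') p') ∉ ℂ ∙ a := by
      intro hmem
      rw [LinearMap.add_apply, LinearMap.smul_apply, map_add, map_smul] at hmem
      have h := Submodule.sub_mem _ hmem (hℓ B₀ hB₀ hΘB₀ hB₀Θ p' hp'P)
      rw [add_sub_cancel_left] at h
      exact hB₀C'p' ((Submodule.smul_mem_iff _ ht).1 h)
    have hmeet : ∀ x, x ∈ ℂ ∙ aₜ → x ∈ ℂ ∙ a → x = 0 := by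
      intro x hx hxa
      obtain ⟨c, rfl⟩ := Submodule.mem_span_singleton.1 hx
      by_cases hc : c = 0
      · rw [hc, zero_smul]
      · exfalso
        have haₜ : aₜ ∈ ℂ ∙ a := (Submodule.smul_mem_iff _ hc).1 hxa
        exact hB₀t ((Submodule.span_singleton_le_iff_mem aₜ _).2 haₜ (hℓt B₀ hB₀ hΘB₀ hB₀Θ p' hp'P))
    exact hmeet _ (hℓt B₁ hB₁ hΘB₁ hB₁Θ p hp) (hvals _)
  have hkillC : ∀ B₁ ∈ 𝔊, Θ * B₁ = B₁ → B₁ * Θ = -B₁ → (∀ w, B₁ w ∈ ℂ ∙ a) → ∀ p ∈ P, B₁ (C p) = 0 := by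
    intro B₁ hB₁ hΘB₁ hB₁Θ hvals p hp
    have h1 := hkill t ht0 hgt B₁ hB₁ hΘB₁ hB₁Θ hvals p hp
    have h2 := hkill t' ht'0 hgt' B₁ hB₁ hΘB₁ hB₁Θ hvals p hp
    rw [LinearMap.add_apply, LinearMap.smul_apply, map_add, map_smul] at h1 h2
    have h : (t - t') • B₁ (C' p) = 0 := by rw [sub_smul]; exact sub_eq_zero.2 (by
      have := h1.trans h2.symm; exact add_left_cancel this)
    rw [smul_eq_zero] at h
    rcases h with h | h
    · exact absurd (sub_eq_zero.1 h) htt'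
    · rw [h, smul_zero, add_zero] at h1; exact h1
  -- a kernel vector of `B₀C|_P`
  obtain ⟨p₁, hp₁P, hB₀Cp₁, hp₁0⟩ := hno B₀ hB₀ C hC hΘB₀ hB₀Θ hΘC hCΘ
  have hπ₀ : C p₁ ≠ 0 := fun h => hp₁0 (hCinj p₁ hp₁P h)
  -- every raising operator kills `π₀ = C p₁`
  have hb₀P : B₀ q' ∈ P := hraise_into B₀ hΘB₀ q'
  have hall : ∀ B ∈ 𝔊, Θ * B = B → B * Θ = -B → B (C p₁) = 0 := by
    intro B hB hΘB hBΘ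
    obtain ⟨x, c, hxc⟩ := UnitaryThetaCore.exists_pair_coords_of_not_mem hP2 haP hb₀P ha0 hB₀q'
      (hraise_into B hΘB q')
    -- `B₁ = B - c B₀` has all its values in `ℓ`
    have hB₁mem : B - c • B₀ ∈ 𝔊 := Submodule.sub_mem _ hB (Submodule.smul_mem _ c hB₀)
    have hΘB₁ : Θ * (B - c • B₀) = B - c • B₀ := by rw [mul_sub, mul_smul_comm, hΘB, hΘB₀]
    have hB₁Θ : (B - c • B₀) * Θ = -(B - c • B₀) := by rw [sub_mul, smul_mul_assoc, hBΘ, hB₀Θ, smul_neg, neg_sub']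
    have hvals : ∀ w, (B - c • B₀) w ∈ ℂ ∙ a := by
      intro w
      rw [← hsplit w, map_add, hraiseP _ hB₁Θ _ (hPhat w), zero_add]
      obtain ⟨u, ⟨p'', hp'', rfl⟩, s, hs⟩ := hQdec _ (hQhat w)
      rw [hs, map_add, map_smul, LinearMap.sub_apply, LinearMap.smul_apply, LinearMap.sub_apply,
        LinearMap.smul_apply, hxc, add_sub_cancel_right]
      exact Submodule.add_mem _ (Submodule.sub_mem _ (hℓ B hB hΘB hBΘ p'' hp'')
        (Submodule.smul_mem _ _ (hℓ B₀ hB₀ hΘB₀ hB₀Θ p'' hp'')))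
        (Submodule.smul_mem _ _ (Submodule.smul_mem _ _ (Submodule.mem_span_singleton_self a)))
    have h := hkillC _ hB₁mem hΘB₁ hB₁Θ hvals p₁ hp₁P
    rw [LinearMap.sub_apply, LinearMap.smul_apply, hB₀Cp₁, smul_zero, sub_zero] at h
    exact h
  obtain ⟨B, hB, h1, h2, hBπ⟩ := h1b (C p₁) (hlower_into C hΘC p₁) hπ₀
  exact hBπ (hall B hB h1 h2)

/-- **THE `Θ`-SUBALGEBRA THEOREM FOR UNITARY MULTIPLICITIES `(2,3)`, complex core**: a bracket-closed `𝔊 ⊆ End(W)`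
containing `1` and an involution `Θ` with eigenspaces of dimensions `2` and `3`, and acting irreducibly on `W`, is
ALL of `End(W)`. (`exists_fullRank_pair` with `eq_top_of_fullRank_pair`; for eigenspace dimensions `(3,2)` apply it
to `−Θ`.) This is the classification-free replacement of Serre's Prop. 5 in Ribet's Theorem 3 at `(n′,n″) = (2,3)`.
[cite: Ribet1983, Thm. 3] [cite: Gordon1997, Thm. 6.3.3 and pp. 18–19] [cite: MoonenZarhin1999LowDim, §2 (2.4) and Thm. (2.7)]
[cite: Humphreys1972, §19.1] -/
theorem UnitaryThetaCore.eq_top_two_three [FiniteDimensional ℂ W] {𝔊 : Submodule ℂ (Module.End ℂ W)}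
    (hbr : ∀ Y ∈ 𝔊, ∀ Z ∈ 𝔊, Y * Z - Z * Y ∈ 𝔊) (h1 : (1 : Module.End ℂ W) ∈ 𝔊)
    (hirr : ∀ U : Submodule ℂ W, (∀ A ∈ 𝔊, ∀ u ∈ U, A u ∈ U) → U = ⊥ ∨ U = ⊤)
    {Θ : Module.End ℂ W} (hΘ : Θ ∈ 𝔊) (hΘΘ : Θ * Θ = 1)
    {P Q : Submodule ℂ W} (hP : ∀ x, x ∈ P ↔ Θ x = x) (hQ : ∀ x, x ∈ Q ↔ Θ x = -x)
    (hP2 : Module.finrank ℂ P = 2) (hQ3 : Module.finrank ℂ Q = 3) : 𝔊 = ⊤ := by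
  obtain ⟨B, hB, C, hC, hΘB, hBΘ, hΘC, hCΘ, hinj⟩ :=
    UnitaryThetaCore.exists_fullRank_pair hbr hirr hΘ hΘΘ hP hQ hP2 hQ3
  exact UnitaryThetaCore.eq_top_of_fullRank_pair hbr h1 hirr hΘ hΘΘ hP hQ (by rw [hP2, hQ3]) hB hC hΘB hBΘ
    hΘC hCΘ hinj

/-- A rank-one idempotent `u ⊗ φ` together with ALL commutators of `End(W)` generates `1`:
`1 = e + Σᵢ kᵢ ⊗ κᵢ` along a basis `kᵢ` of `ker φ` with `κᵢ = kᵢ^* ∘ (1 − e)`, and `kᵢ ⊗ κᵢ − e = [kᵢ ⊗ φ, u ⊗ κᵢ]`.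
[folklore] -/
private theorem UnitaryThetaCore.one_mem_of_rankOne_idempotent [FiniteDimensional ℂ W]
    {𝔊 : Submodule ℂ (Module.End ℂ W)} (hcomm : ∀ X Y : Module.End ℂ W, X * Y - Y * X ∈ 𝔊)
    {u : W} {φ : Module.Dual ℂ W} (hφu : φ u = 1) (he : φ.smulRight u ∈ 𝔊) :
    (1 : Module.End ℂ W) ∈ 𝔊 := by
  classical
  set K : Submodule ℂ W := LinearMap.ker φ with hKdef
  have hπmem : ∀ w, ((LinearMap.id : Module.End ℂ W) - φ.smulRight u) w ∈ K := fun w => by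
    rw [hKdef, LinearMap.mem_ker, LinearMap.sub_apply, LinearMap.id_apply, LinearMap.smulRight_apply, map_sub,
      map_smul, hφu, smul_eq_mul, mul_one, sub_self]
  set π : W →ₗ[ℂ] K := LinearMap.codRestrict K ((LinearMap.id : Module.End ℂ W) - φ.smulRight u) hπmem
    with hπdef
  have hπapply : ∀ w, (π w : W) = w - φ w • u := fun w => rfl
  set b := Module.finBasis ℂ K with hbdef
  have hsum : ∑ i, ((b.coord i) ∘ₗ π).smulRight (b i : W) = 1 - φ.smulRight u := by
    refine LinearMap.ext fun w => ?_
    rw [LinearMap.sum_apply, LinearMap.sub_apply, Module.End.one_apply, LinearMap.smulRight_apply, ← hπapply]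
    simp only [LinearMap.smulRight_apply, LinearMap.comp_apply, Module.Basis.coord_apply]
    have h := congrArg Subtype.val (b.sum_repr (π w))
    simpa only [Submodule.coe_sum, Submodule.coe_smul] using h
  have hterm : ∀ i, ((b.coord i) ∘ₗ π).smulRight (b i : W) - φ.smulRight u ∈ 𝔊 := by
    intro i
    have hk : φ (b i : W) = 0 := (b i).2
    have hπk : π (b i : W) = b i := by
      apply Subtype.ext
      rw [hπapply, hk, zero_smul, sub_zero]
    have hκk : (b.coord i) (π (b i : W)) = 1 := by
      rw [hπk, Module.Basis.coord_apply, Module.Basis.repr_self, Finsupp.single_eq_same]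
    have hid : (φ.smulRight (b i : W)) * (((b.coord i) ∘ₗ π).smulRight u) -
        (((b.coord i) ∘ₗ π).smulRight u) * (φ.smulRight (b i : W)) =
        ((b.coord i) ∘ₗ π).smulRight (b i : W) - φ.smulRight u := by
      refine LinearMap.ext fun w => ?_
      simp only [LinearMap.sub_apply, Module.End.mul_apply, LinearMap.smulRight_apply, LinearMap.comp_apply,
        map_smul, hφu, hκk, one_smul]
    exact hid ▸ hcomm _ _
  have h1 : (1 : Module.End ℂ W) = φ.smulRight u +
      ∑ i, ((((b.coord i) ∘ₗ π).smulRight (b i : W) - φ.smulRight u) + φ.smulRight u) := by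
    simp only [sub_add_cancel]
    rw [hsum, add_sub_cancel]
  rw [h1]
  exact Submodule.add_mem _ he (Submodule.sum_mem _ fun i _ => Submodule.add_mem _ (hterm i) he)

/-- **THE `Θ`-SUBALGEBRA THEOREM FOR UNITARY MULTIPLICITIES `(2,3)` WITHOUT `1 ∈ 𝔊`** (appended): a bracket-closed
`𝔊 ⊆ End(W)` containing an involution `Θ` with eigenspaces of dimensions `2` and `3`, and acting irreducibly, is
ALL of `End(W)` — in particular it contains the scalars (Gordon: «because `n′ ≠ n″`, this generates a torus distinct
from the diagonal»; here: `𝔊 + ℂ1 = End(W)` by `eq_top_two_three`, so `𝔊` contains all commutators, and it contains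
the rank-one idempotent `E = −Θ − δ⁻¹(χ(BC) − χ(CB))` of `exists_rankOne_idempotent'`, whence `1 ∈ 𝔊`).
[cite: Ribet1983, Thm. 3] [cite: Gordon1997, Thm. 6.3.3 and pp. 18–19] [cite: MoonenZarhin1999LowDim, §2 (2.4) and Thm. (2.7)] -/
theorem UnitaryThetaCore.eq_top_two_three' [FiniteDimensional ℂ W] {𝔊 : Submodule ℂ (Module.End ℂ W)}
    (hbr : ∀ Y ∈ 𝔊, ∀ Z ∈ 𝔊, Y * Z - Z * Y ∈ 𝔊)
    (hirr : ∀ U : Submodule ℂ W, (∀ A ∈ 𝔊, ∀ u ∈ U, A u ∈ U) → U = ⊥ ∨ U = ⊤)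
    {Θ : Module.End ℂ W} (hΘ : Θ ∈ 𝔊) (hΘΘ : Θ * Θ = 1)
    {P Q : Submodule ℂ W} (hP : ∀ x, x ∈ P ↔ Θ x = x) (hQ : ∀ x, x ∈ Q ↔ Θ x = -x)
    (hP2 : Module.finrank ℂ P = 2) (hQ3 : Module.finrank ℂ Q = 3) : 𝔊 = ⊤ := by
  classical
  obtain ⟨B, hB, C, hC, hΘB, hBΘ, hΘC, hCΘ, hinj⟩ :=
    UnitaryThetaCore.exists_fullRank_pair hbr hirr hΘ hΘΘ hP hQ hP2 hQ3
  obtain ⟨u, φ, hφu, he⟩ := UnitaryThetaCore.exists_rankOne_idempotent' hbr hΘ hΘΘ hP hQ (by rw [hP2, hQ3]) hB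
    hC hΘB hBΘ hΘC hCΘ hinj
  -- `𝔊' = 𝔊 + ℂ·1` is everything
  set 𝔊' : Submodule ℂ (Module.End ℂ W) := 𝔊 ⊔ (ℂ ∙ (1 : Module.End ℂ W)) with h𝔊'
  have hbr_smul : ∀ (Y₁ Z₁ : Module.End ℂ W) (a c : ℂ),
      (Y₁ + a • (1 : Module.End ℂ W)) * (Z₁ + c • 1) - (Z₁ + c • 1) * (Y₁ + a • 1) = Y₁ * Z₁ - Z₁ * Y₁ := by
    intro Y₁ Z₁ a c
    refine LinearMap.ext fun w => ?_
    simp only [LinearMap.sub_apply, Module.End.mul_apply, LinearMap.add_apply, LinearMap.smul_apply,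
      Module.End.one_apply, map_add, map_smul]
    module
  have hdec : ∀ Y ∈ 𝔊', ∃ Y₁ ∈ 𝔊, ∃ a : ℂ, Y = Y₁ + a • 1 := fun Y hY => by
    obtain ⟨Y₁, hY₁, Y₂, hY₂, rfl⟩ := Submodule.mem_sup.1 hY
    obtain ⟨a, rfl⟩ := Submodule.mem_span_singleton.1 hY₂
    exact ⟨Y₁, hY₁, a, rfl⟩
  have hbr' : ∀ Y ∈ 𝔊', ∀ Z ∈ 𝔊', Y * Z - Z * Y ∈ 𝔊' := by
    intro Y hY Z hZ
    obtain ⟨Y₁, hY₁, a, rfl⟩ := hdec Y hY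
    obtain ⟨Z₁, hZ₁, c, rfl⟩ := hdec Z hZ
    rw [hbr_smul]
    exact Submodule.mem_sup_left (hbr Y₁ hY₁ Z₁ hZ₁)
  have hirr' : ∀ U : Submodule ℂ W, (∀ A ∈ 𝔊', ∀ u ∈ U, A u ∈ U) → U = ⊥ ∨ U = ⊤ := fun U hU =>
    hirr U fun A hA v hv => hU A (Submodule.mem_sup_left hA) v hv
  have htop : 𝔊' = ⊤ :=
    UnitaryThetaCore.eq_top_two_three hbr' (Submodule.mem_sup_right (Submodule.mem_span_singleton_self _)) hirr'
      (Submodule.mem_sup_left hΘ) hΘΘ hP hQ hP2 hQ3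
  -- hence `𝔊` contains all commutators, and `1`
  have hcomm : ∀ X Y : Module.End ℂ W, X * Y - Y * X ∈ 𝔊 := by
    intro X Y
    obtain ⟨X₁, hX₁, a, rfl⟩ := hdec X (htop ▸ Submodule.mem_top)
    obtain ⟨Y₁, hY₁, c, rfl⟩ := hdec Y (htop ▸ Submodule.mem_top)
    rw [hbr_smul]
    exact hbr X₁ hX₁ Y₁ hY₁
  have h1 : (1 : Module.End ℂ W) ∈ 𝔊 := UnitaryThetaCore.one_mem_of_rankOne_idempotent hcomm hφu he
  exact UnitaryThetaCore.eq_top_two_three hbr h1 hirr hΘ hΘΘ hP hQ hP2 hQ3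

end Pencil

end HodgeStructure

end Literature.AlgebraicGeometry.Motives

end
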